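import Literature.MathematicalPhysics.QuantumFieldTheory.Balaban1983to89.B5ActionRate166
import Literature.MathematicalPhysics.QuantumFieldTheory.King1986.AveragingWeightRate
import Literature.MathematicalPhysics.QuantumFieldTheory.Balaban1983to89.B5Symbol163
import Literature.MathematicalPhysics.QuantumFieldTheory.Balaban1983to89.B5Hk163Strip

/-!
# `Balaban1983to89.B5Hk163Rate` — the η-RATE of the (1.63) momentum multiplier of `H_k` at real fine-zone momenta: King's scalar §4 mechanism ((4.20)/(4.21) alias-decay majorants, (4.24)/(4.29)–(4.31) «successively replace each factor … and bound the error») transferred to Bałaban's Landau-gauge vector layer (cell node X10, Fourier side; spine estimate NE2 (U1a))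

HONEST FRAMING (page 1).  Rung (B)+1 bookkeeping on a FINITE torus `T_η`, `η = 1/N` (in the papers `N = L^k`),
gauge group U(1), background field switched OFF (`U = 1`), LINEAR (Gaussian) theory.  This is NOT an infinite-volume
statement, NOT a mass-gap statement, NOT a statement about the Clay problem and NOT summit progress: it is a kernel
certificate for ONE input — the momentum-space η-rate of the multiplier of `H_k` — of the cell's spine estimate NE2,
conditional on nothing (no `BetaPertH`, no hypothesis (B)/(B^μ) enters: the statements are about explicit
trigonometric rational functions).  Value = audit mathematics answering the Fourier half of cell GAPS row G-ne2p1-1.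

SOURCES (locations of printed TEXT only; nothing printed is used as a hypothesis).
* T. Bałaban, *Propagators and renormalization transformations for lattice gauge theories. I*, Commun. Math. Phys.
  **95** (1984) 17–40 [`Balaban1984PropagatorsI`, cell paper B5]: (1.61)–(1.63) p. 28 — the second expression of
  (1.63) for `(H_kB)~_μ(p′+l)`, typed symbol-agnostically as `B5Symbol163.second163` (tree) and identified on the
  torus with the regrouped multiplier `B5Hk163Strip.h163` (tree, `second163_eq_sum_h163`).
* C. King, *The U(1) Higgs model. I. The continuum limit*, Commun. Math. Phys. **102** (1986) 649–677 [`King1986`],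
  §4 pp. 672–673 (renders `1986-cmp102-king-u1-higgs-I-p024-x2.png`, `…-p025-x2.png`, read as images by this unit).
  VERBATIM, p. 672: «Using the representation (4.2), we shall now establish the last bound in (3.71). The rest of
  Proposition 3.8 is simpler.» … «We have the following bounds: |u^{η′}_{k+n}(p′+l+m)| < C Π_{μ=1}^d |p′_μ||(p′+l+m)_μ|^{−1},
  (4.20)  |Δ^{(k+n)}(p′)Δ^{η′}(p′+l+m)^{−1}| ≤ C|p′|²|p′+l+m|^{−2}. (4.21)  Also (η′)^{−1}|exp[iη′(p′+l+m)_μ] − 1|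
  ≤ C|(p′+l+m)_μ| …» … «To analyze the m = 0 term in (4.19), we successively replace each factor by the corresponding
  one in the expression for (∂_α(x, y)∂^η_μ a_kG^η_kQ^*_k)(z) and bound the error. We must always be careful to keep
  enough negative powers of momentum so that the sum over l is bounded.»;  p. 673: «Lemma 4.4.
  |u^η_k(p′+l) − u^{η′}_{k+n}(p′+l)| ≤ CL^{−γk}|p′+l|^γ|u^η_k(p′+l)|. (4.29)» … «By repeated use of the identity
  xy − zw = 1/2(x−y)(z+w) + 1/2(x+y)(z−w), we can write the difference inside the last bracket of (4.30) as a sum of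
  2^{d−1} terms. …» … «Therefore we can replace u^{η′}_{k+n}(p′+l) by u^η_k(p′+l) and bound the error. Lemma 4.3 allows
  us to replace Δ^{(k+n)}(p′) by Δ^{(k)}(p′). Finally, from (4.7) |Δ^{η′}(p′+l)^{−1} − Δ^η(p′+l)^{−1}| ≤ CL^{−2k}
  ≤ CL^{−γk}|p′+l|^{−2+γ}. (4.31)».
  King's text is about the SCALAR operator `a_kG_kQ^*_k` of the U(1) Higgs model at `A = 0`; nothing in King concerns
  Bałaban's `H_k`.  What is TRANSFERRED is the MECHANISM of (4.20)–(4.31) — alias-decay majorants with cut-off-uniform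
  constants, then factor-by-factor replacement with RELATIVE rates — applied to the factors of (1.63).  Every estimate
  below is proved in the kernel from tree modules and tagged `[folklore]`.

CITATION HEADER (lean-in-tree rule).  `[cite: …]` tags mark the location of printed TEXT only; all mathematics is
`[folklore]` audit mathematics proved here.  ABSOLUTE RULE honoured: no statement of B5 or of King (and a fortiori no
programme-internal claim) enters as a hypothesis; the imports are kernel-proved tree modules (`B5ActionRate166` = the
η-rates of `φ_μ` (1.62) and of `ψ` [generation 1 of this lineage], `King1986.AveragingWeightRate` = Lemma 4.4 proved,
`B5Symbol163` = the typed display (1.63), `B5Hk163Strip` = b05's regrouped multiplier `h163` with its torus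
identification).  No constant below (`A163`, `B163`, `maj163`, `vMaj`, …) is attributed to print.

THE OBJECT.  Fix `d`, a level `n ≥ 1` (`η = 1/n`), a coarse momentum `p′ = s ∈ [−π,π]^d ∖ {0}` and directions `μ, λ`.
The coefficient of `B̃_λ(p′)` in `(H_kB)~_μ(p′+l)` depends on the alias `l = 2πk`, `k ∈ (ℤ/n)^d`, only through the
PHYSICAL fine momentum `q = p′ + l (mod 2πn)`; §1 writes it as an explicit function `hPhys n μ λ q p′` of `(q, p′)` built
from King's one-cut-off leaves (`King1986.uWeight (1/n) q = ū(q)`, `uFac (1/n) (q_μ) = v̄_μ(q)`,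
`conj (fdq (1/n) (q_μ)) = ∂_μ(q)`, `DeltaXir n 0 q = Δ^η(q)`) and the `p′`-side functions
`φ_μ = B5Bounds167Lattice.phi162`, `ψ = B5ActionRate166.psiSum`, `E = E1` (real, positive on the punctured zone):
  `h = δ_{μλ}·ū v̄_μ/(Δ^η(q) φ_μ) + ∂_μ(q) ū/Δ^η(q) · [φ_μ/(Δ^η(q)ψ) − |v̄_μ|²] · conj ∂¹_λ/(φ_μ φ_λ E)`;
the printed `Δ₀(p′)`-powers cancel exactly (`Δ₀/Δ·(Δ₀φ)⁻¹ = 1/(Δφ)`; `Δ₀²·S⁻¹·(Δ₀φ_μ)⁻¹·N⁻¹·Δ₀⁻¹ = (ψφ_μE)⁻¹`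
with `S = Δ₀²ψ`, `N = E/Δ₀²`).

CONTENT AND WHAT IS PROVED (all `[folklore]`, kernel-checked).
* §0 leaf inequalities for King's one-cut-off functions at two cut-offs `η = 1/N`, `η′ = 1/(RN)` (any `R ≥ 1`; in the
  papers `R = L^n`): `uWeight_rate` (Lemma 4.4 as `‖ū_N(q) − ū_{RN}(q)‖ ≤ (π/2)^{d+1}(|q|₁/N)‖ū_N(q)‖`, from the tree's
  `King1986.lemma44`), `uFac_rate`, `fdq_rate` ((4.25) with constant 1; sharp: 1/2), `normSq_uFac_rate`; for the effective
  Laplacian `Δ^η(q) = DeltaXir`: `DeltaXir_ge_momSq` (Jordan, `≥ (4/π²)|q|²` on the fine zone), `DeltaXir_sub_le`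
  (`|Δ^η − Δ^{η′}| ≤ (π/12)(|q|₁/N)|q|²`), `inv_DeltaXir_sub_le` — the refinement analogue of (4.31) in the currency
  `η|q|₁` (King trades the same powers: `L^{−2k} ≤ L^{−γk}|p′+l|^{−2+γ}`); alias decay of one factor `norm_uFac_le_alias`
  (`‖v̄(q_ν)‖ ≤ (π/2)|p′_ν|/|q_ν|` on an aliased coordinate — one factor of (4.20)).
* §1 `E1`, `hPhys`.
* §2 BRIDGES torus symbols ↔ King leaves for a zone representative `q` of the alias class of `(k, s)` (`IsRep n k s q`:
  `shiftr n k s − q ∈ 2πn·ℕ^d`, `|q_ν| ≤ πn`): `dSym = conj fdq`, `conj vSym = uFac`, `conj uSym = uWeight`,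
  `DeltaXir ∘ shiftr = DeltaXir q`, `sSym = Δ₀²ψ`, `nSym = E/Δ₀²`, and the IDENTIFICATION on the typed display
  `second163_torus_eq_sum_hPhys : B5Symbol163.second163 (torus leaves) B̃ μ k = Σ_λ hPhys n μ λ q s · B̃_λ`.
* §3 PAIRING of alias indices across levels: `iota R k s ∈ (ℤ/RN)^d` with `symmAlias (RN) (iota R k s) s = symmAlias N k s`
  (the level-`N` symmetric representative `King1986.symmAlias` represents the paired level-`RN` class), `iota` injective.
* §4 THEOREM A `norm_hPhys_le` — the ALIAS-DECAY MAJORANT ((4.20)/(4.21) shape): for every `n ≥ 1` and every alias `q`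
  of `p′` in the level-`n` fine zone, `‖hPhys n μ λ q p′‖ ≤ maj163 d p′ q μ λ`, where `maj163` carries `Π_ν vMaj`
  (`vMaj = 1` on an unaliased coordinate `q_ν = p′_ν`, `(π/2)|p′_ν|/|q_ν|` on an aliased one — King's
  `Π_μ|p′_μ||(p′+l+m)_μ|^{−1}`), the `(π²/4)|q|^{−2}` of `Δ^η(q)^{−1}`, and `p′`-side factors `Δ₀(p′)/γ₀`, `1/Δ₀(p′)²`, …
  (`γ₀ = T4GaugeActionRate.gam0 d = (4/π²)^{d+2}`); the constants depend on `d` only, NOT on `n`.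
* §5 THEOREM B `hPhys_rate` — the η-RATE ((4.24)/(4.29)–(4.31) transferred): for `N, R ≥ 1` and `q` an alias of `p′`
  in the level-`N` fine zone, `‖hPhys N μ λ q p′ − hPhys (RN) μ λ q p′‖ ≤ (A163 d·|q|₁/N + B163 d/N²)·maj163 d p′ q μ λ`
  — RELATIVE to the majorant of Theorem A, uniformly in `R`; `|q|₁/N = η|q|₁` is King's `η|p′+l|`-type loss
  ((4.24)/(4.25)/(4.29) with `γ = 1`) of the `q`-side factors and `1/N² = η²` the rate of the `p′`-side functions
  (`B5ActionRate166.phi162_rate`, `Psi_rate`).  The proof IS King's sentence: `hPhys_eq_prod` writes `h` as `δ_{μλ}·`(a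
  product of 4 factors) `+` (a product of 8 factors), `rate_mul` is «the identity xy − zw = …» with uniform majorants,
  and the per-factor bounds / rates are §0, §4 and `inv_phi162_rate`, `inv_psiSum_rate`, `inv_E1_rate`, `bracket_rate`.
* §6 TRANSPORT to b05's regrouped multiplier: `h163_ofReal_eq_hPhys` (`B5Hk163Strip.h163 n μ λ k (ofRealVec s)
  = hPhys n μ λ q s` for every zone representative `q`, from `second163_eq_sum_h163` with `B̃ = e_λ`), hence
  `norm_h163_ofReal_le` (Theorem A for `h163` at real momenta — the alias decay that `B5Hk163Strip.norm_h163_le` does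
  not claim) and `h163_rate` (Theorem B between the level-`N` multiplier at alias `k` and the level-`RN` multiplier at
  the paired alias `iota R k s`, both at the common physical momentum `symmAlias N k s`).

WHAT IS NOT CLAIMED (typed residuals for the carver).  (i) Position space: the passage from Theorems A/B to «the last
bound in (3.71)» — King's (4.19) with the Hölder weights (4.22)–(4.28), the `dp′`-integral and the alias SUM `Σ_l`
(the tree's `King1986.AliasSums.alias_sum_le` sums exactly the `Π|p′_ν|/|q_ν|` majorant of Theorem A, but the
bookkeeping `(2π)^{−d}∫dp′ Σ_l maj163·|q|^{α−1}`, incl. the `|q_μ|` of the tail's `∂_μ(q)` against `|q|^{−2}`, is NOT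
done here).  (ii) The UNPAIRED level-`RN` aliases (`k″ ∉ range (iota R · s)` — King's `m ≠ 0` terms (4.23)): Theorem A
bounds each of them, but no smallness-in-`N` statement for their sum is made here.  (iii) The strip / contour-shift
side: `B5Hk163Strip` §4–§6 is the complex half; Theorems A/B are REAL-momentum statements.  (iv) `U ≠ 1` backgrounds
(NE2⁺), the covariance `C^{(k)}` (X5), and any operator identity on `T_η`.  (v) Constants are crude; only their
dependence on `d` alone matters.  Unit `b2b-balaban-t4-ne2-p1-g3` (T4 cell, lane NE2-P1, generation 3).

VERSION.  v1 p185558 (a2c885c05b72).  v1.1 DOCFIX (this text): `[folklore]` tags added to the five kernel-proved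
theorems `DeltaXir_ge_momSq`, `DeltaXir_le_momSq`, `uWeight_rate`, `uFac_rate`, `fdq_rate` whose docstrings carried a
bare `[cite:]` locator (XREAD C-adv4-83 advisory A1; the `[cite:]` marks the printed inequality each one transcribes,
the proof is ours); A2: `fdq_rate`'s constant `1` is not sharp (`1/2` is).  No declaration, statement or proof changed.
The alias-SUM rates ((ii) above and the weighted sum of (i), Fourier side) are in the sibling `B5Hk163RateSum` (p185807).
-/

noncomputable section

namespace Literature.MathematicalPhysics.QuantumFieldTheory.Balaban1983to89.B5Hk163Rate

open scoped BigOperators ComplexConjugate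
open Finset Complex
open Literature.MathematicalPhysics.QuantumFieldTheory.Balaban1983to89.B4Strip
open Literature.MathematicalPhysics.QuantumFieldTheory.Balaban1983to89.B5Prop11Leaves
open Literature.MathematicalPhysics.QuantumFieldTheory.Balaban1983to89.B5Prop11Fiber
open Literature.MathematicalPhysics.QuantumFieldTheory.Balaban1983to89.B5Bounds167Lattice (phi162)
open Literature.MathematicalPhysics.QuantumFieldTheory.Balaban1983to89.B5ActionRate166 (psiSum Cphi Cpsi)
open Literature.MathematicalPhysics.QuantumFieldTheory.Balaban1983to89.B5Symbol163
open Literature.MathematicalPhysics.QuantumFieldTheory.King1986 (fdq uFac uWeight symmAlias symmShift momSq)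

variable {d : ℕ}

/-! ## §0 Leaf inequalities: King's one-cut-off functions and the fine symbol `Δ^η` at two cut-offs

### products with uniform majorants and relative rates -/

/-- telescoping for products with UNIFORM majorants: `‖a_i‖, ‖b_i‖ ≤ M_i`, `‖a_i − b_i‖ ≤ ε_i M_i`
`⇒ ‖Π a − Π b‖ ≤ (Σ ε_i)·Π M_i`. [folklore] -/
theorem norm_prod_sub_prod_le_maj {ι : Type*} [DecidableEq ι] (s : Finset ι) (a b : ι → ℂ) (M ε : ι → ℝ)
    (hM : ∀ i ∈ s, 0 ≤ M i) (hε : ∀ i ∈ s, 0 ≤ ε i) (ha : ∀ i ∈ s, ‖a i‖ ≤ M i) (hb : ∀ i ∈ s, ‖b i‖ ≤ M i)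
    (hab : ∀ i ∈ s, ‖a i - b i‖ ≤ ε i * M i) :
    ‖∏ i ∈ s, a i - ∏ i ∈ s, b i‖ ≤ (∑ i ∈ s, ε i) * ∏ i ∈ s, M i := by
  induction s using Finset.induction_on with
  | empty => simp
  | @insert j s hj ih =>
    have hM' : ∀ i ∈ s, 0 ≤ M i := fun i hi => hM i (mem_insert_of_mem hi)
    have hε' : ∀ i ∈ s, 0 ≤ ε i := fun i hi => hε i (mem_insert_of_mem hi)
    have ha' : ∀ i ∈ s, ‖a i‖ ≤ M i := fun i hi => ha i (mem_insert_of_mem hi)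
    have hb' : ∀ i ∈ s, ‖b i‖ ≤ M i := fun i hi => hb i (mem_insert_of_mem hi)
    have hab' : ∀ i ∈ s, ‖a i - b i‖ ≤ ε i * M i := fun i hi => hab i (mem_insert_of_mem hi)
    have ih' := ih hM' hε' ha' hb' hab'
    rw [prod_insert hj, prod_insert hj, sum_insert hj, prod_insert hj]
    have hPa : ‖∏ i ∈ s, a i‖ ≤ ∏ i ∈ s, M i := by
      rw [norm_prod]; exact prod_le_prod (fun i _ => norm_nonneg _) ha'
    have hPM : 0 ≤ ∏ i ∈ s, M i := prod_nonneg hM'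
    have hSε : 0 ≤ ∑ i ∈ s, ε i := sum_nonneg hε'
    have hMj := hM j (mem_insert_self j s)
    have hεj := hε j (mem_insert_self j s)
    calc ‖a j * ∏ i ∈ s, a i - b j * ∏ i ∈ s, b i‖
        = ‖(a j - b j) * ∏ i ∈ s, a i + b j * (∏ i ∈ s, a i - ∏ i ∈ s, b i)‖ := by ring_nf
      _ ≤ ‖a j - b j‖ * ‖∏ i ∈ s, a i‖ + ‖b j‖ * ‖∏ i ∈ s, a i - ∏ i ∈ s, b i‖ := by
          refine (norm_add_le _ _).trans ?_; rw [norm_mul, norm_mul]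
      _ ≤ ε j * M j * ∏ i ∈ s, M i + M j * ((∑ i ∈ s, ε i) * ∏ i ∈ s, M i) := by
          gcongr
          · exact hab j (mem_insert_self j s)
          · exact hb j (mem_insert_self j s)
      _ = (ε j + ∑ i ∈ s, ε i) * (M j * ∏ i ∈ s, M i) := by ring

/-! ### the fine symbol `Δ^{(n)}(q)` and its refinement rate -/

/-- `Δ^{(n)}(q) ≥ (4/π²)|q|²` in the fine zone. [cite: King1986, (4.9) p.671] [folklore] -/
theorem DeltaXir_ge_momSq {n : ℕ} (hn : 1 ≤ n) {q : Fin d → ℝ} (hq : ∀ ν, |q ν| ≤ Real.pi * n) :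
    4 / Real.pi ^ 2 * momSq q ≤ DeltaXir n 0 q := by
  have hn0 : n ≠ 0 := by omega
  rw [King1986.DeltaXir_eq_latticeSymbol hn0]
  have h := King1986.latticeSymbol_ge_jordan (η := ((n : ℝ)⁻¹)) (inv_ne_zero (by exact_mod_cast hn0)) 0
    (p := q) (fun ν => ?_)
  · simpa using h
  · have hn' : (0 : ℝ) < n := by exact_mod_cast Nat.pos_of_ne_zero hn0
    rw [abs_mul, abs_inv, abs_of_pos hn', inv_mul_le_iff₀ hn']
    linarith [hq ν]

/-- `Δ^{(n)}(q) ≤ |q|²`. [cite: King1986, (4.9) p.671] [folklore] -/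
theorem DeltaXir_le_momSq {n : ℕ} (hn : 1 ≤ n) (q : Fin d → ℝ) : DeltaXir n 0 q ≤ momSq q := by
  have hn0 : n ≠ 0 := by omega
  rw [King1986.DeltaXir_eq_latticeSymbol hn0]
  simpa using King1986.latticeSymbol_le (η := ((n : ℝ)⁻¹)) (inv_ne_zero (by exact_mod_cast hn0)) 0 q

/-- the refinement rate of the fine symbol: `|Δ^{(N)}(q) − Δ^{(RN)}(q)| ≤ (π/12)·(Σ_ν|q_ν|/N)·|q|²` on the zone
`|q_ν| ≤ πN` (from `x² − η²x⁴/12 ≤ 4η⁻²sin²(ηx/2) ≤ x²`). [cite: King1986, (4.10) p.671] [folklore] -/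
theorem DeltaXir_sub_le {N R : ℕ} (hN : 1 ≤ N) (hR : 1 ≤ R) {q : Fin d → ℝ} (hq : ∀ ν, |q ν| ≤ Real.pi * N) :
    |DeltaXir N 0 q - DeltaXir (R * N) 0 q| ≤ Real.pi / 12 * ((∑ ν, |q ν|) / N) * momSq q := by
  have hN0 : N ≠ 0 := by omega
  have hRN0 : R * N ≠ 0 := Nat.mul_ne_zero (by omega) hN0
  have hN' : (0 : ℝ) < N := by exact_mod_cast Nat.pos_of_ne_zero hN0
  have hπ := Real.pi_pos
  -- coordinatewise: both symbols lie in `[x² − x⁴/(12N²), x²]`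
  have hco : ∀ ν, |Sxir N (q ν) - Sxir (R * N) (q ν)| ≤ (q ν) ^ 4 / (12 * N ^ 2) := by
    intro ν
    have hη : ((N : ℝ)⁻¹) ≠ 0 := inv_ne_zero hN'.ne'
    have hRN' : (0 : ℝ) < (R * N : ℕ) := by exact_mod_cast Nat.pos_of_ne_zero hRN0
    have hη' : (((R * N : ℕ) : ℝ)⁻¹) ≠ 0 := inv_ne_zero hRN'.ne'
    have hz : |(N : ℝ)⁻¹ * q ν| ≤ Real.pi := by
      rw [abs_mul, abs_inv, abs_of_pos hN', inv_mul_le_iff₀ hN']; linarith [hq ν]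
    have hz' : |((R * N : ℕ) : ℝ)⁻¹ * q ν| ≤ Real.pi := by
      rw [abs_mul, abs_inv, abs_of_pos hRN', inv_mul_le_iff₀ hRN']
      have : (N : ℝ) ≤ (R * N : ℕ) := by
        have h1 : (1 : ℝ) ≤ R := by exact_mod_cast hR
        push_cast; nlinarith
      nlinarith [hq ν]
    rw [King1986.Sxir_eq_fdSymbol hN0, King1986.Sxir_eq_fdSymbol hRN0]
    have h1 := King1986.fdSymbol_ge_quartic hη hz
    have h2 := King1986.fdSymbol_le_sq hη (q ν)
    have h3 := King1986.fdSymbol_ge_quartic hη' hz'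
    have h4 := King1986.fdSymbol_le_sq hη' (q ν)
    have hq4 : 0 ≤ q ν ^ 4 := by positivity
    have hinv : ((R * N : ℕ) : ℝ)⁻¹ ^ 2 ≤ (N : ℝ)⁻¹ ^ 2 := by
      have : ((R * N : ℕ) : ℝ)⁻¹ ≤ (N : ℝ)⁻¹ := by
        apply inv_anti₀ hN'
        have h1 : (1 : ℝ) ≤ R := by exact_mod_cast hR
        push_cast; nlinarith
      exact pow_le_pow_left₀ (by positivity) this 2
    have e1 : (N : ℝ)⁻¹ ^ 2 / 12 * q ν ^ 4 = q ν ^ 4 / (12 * N ^ 2) := by field_simp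
    rw [abs_le]
    constructor
    · have : ((R * N : ℕ) : ℝ)⁻¹ ^ 2 / 12 * q ν ^ 4 ≤ q ν ^ 4 / (12 * N ^ 2) := by
        rw [div_mul_eq_mul_div, div_le_div_iff₀ (by norm_num) (by positivity)]
        have : ((R * N : ℕ) : ℝ)⁻¹ ^ 2 * (N : ℝ) ^ 2 ≤ 1 := by
          calc ((R * N : ℕ) : ℝ)⁻¹ ^ 2 * (N : ℝ) ^ 2 ≤ (N : ℝ)⁻¹ ^ 2 * (N : ℝ) ^ 2 := by gcongr
            _ = 1 := by field_simp
        nlinarith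
      nlinarith
    · nlinarith
  -- sum and `q_ν⁴/N² ≤ π (|q|₁/N) q_ν²`
  have hsum : DeltaXir N 0 q - DeltaXir (R * N) 0 q = ∑ ν, (Sxir N (q ν) - Sxir (R * N) (q ν)) := by
    unfold DeltaXir; simp [Finset.sum_sub_distrib]
  rw [hsum]
  refine (Finset.abs_sum_le_sum_abs _ _).trans ?_
  have hq1 : ∀ ν, |q ν| ≤ ∑ κ, |q κ| := fun ν =>
    Finset.single_le_sum (fun κ _ => abs_nonneg (q κ)) (Finset.mem_univ ν)
  calc ∑ ν, |Sxir N (q ν) - Sxir (R * N) (q ν)| ≤ ∑ ν, (q ν) ^ 4 / (12 * N ^ 2) := sum_le_sum fun ν _ => hco ν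
    _ ≤ ∑ ν, Real.pi / 12 * ((∑ κ, |q κ|) / N) * (q ν) ^ 2 := by
        refine sum_le_sum fun ν _ => ?_
        have hqν := hq ν
        have h1ν := hq1 ν
        have hx2 : (q ν) ^ 2 = |q ν| ^ 2 := (sq_abs _).symm
        have hx4 : (q ν) ^ 4 = |q ν| ^ 4 := (Even.pow_abs (by decide : Even 4) (q ν)).symm
        rw [hx4, hx2, div_le_iff₀ (by positivity)]
        -- |x|^4 ≤ π/12 * (S/N) * |x|^2 * (12 N²) = π S N |x|²  with |x| ≤ π N, |x| ≤ S
        have hx0 := abs_nonneg (q ν)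
        have hS0 : 0 ≤ ∑ κ, |q κ| := sum_nonneg fun κ _ => abs_nonneg _
        have : |q ν| ^ 4 ≤ (Real.pi * N) * (∑ κ, |q κ|) * |q ν| ^ 2 := by
          have : |q ν| ^ 2 ≤ (Real.pi * N) * ∑ κ, |q κ| := by nlinarith
          nlinarith
        calc |q ν| ^ 4 ≤ (Real.pi * N) * (∑ κ, |q κ|) * |q ν| ^ 2 := this
          _ = Real.pi / 12 * ((∑ κ, |q κ|) / N) * |q ν| ^ 2 * (12 * N ^ 2) := by field_simp
    _ = Real.pi / 12 * ((∑ ν, |q ν|) / N) * momSq q := by rw [← Finset.mul_sum]; rfl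

/-- the rate of the inverse symbol: `|Δ^{(N)}(q)⁻¹ − Δ^{(RN)}(q)⁻¹| ≤ (π³/48)·(|q|₁/N)·(π²/4)/|q|²`.
[cite: King1986, (4.31) p.673] [folklore] -/
theorem inv_DeltaXir_sub_le {N R : ℕ} (hN : 1 ≤ N) (hR : 1 ≤ R) {q : Fin d → ℝ} (hq : ∀ ν, |q ν| ≤ Real.pi * N)
    (hq0 : 0 < momSq q) :
    |(DeltaXir N 0 q)⁻¹ - (DeltaXir (R * N) 0 q)⁻¹|
      ≤ Real.pi ^ 3 / 48 * ((∑ ν, |q ν|) / N) * (Real.pi ^ 2 / 4 / momSq q) := by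
  have hRN : 1 ≤ R * N := Nat.one_le_iff_ne_zero.mpr (Nat.mul_ne_zero (by omega) (by omega))
  have hπ := Real.pi_pos
  have hqRN : ∀ ν, |q ν| ≤ Real.pi * (R * N : ℕ) := by
    intro ν; have h1 : (1 : ℝ) ≤ R := by exact_mod_cast hR
    have := hq ν; push_cast; nlinarith [abs_nonneg (q ν), (show (0:ℝ) ≤ N by positivity)]
  have hA := DeltaXir_ge_momSq hN hq
  have hB := DeltaXir_ge_momSq hRN hqRN
  have hc : 0 < 4 / Real.pi ^ 2 * momSq q := by positivity
  have hA0 : 0 < DeltaXir N 0 q := lt_of_lt_of_le hc hA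
  have hB0 : 0 < DeltaXir (R * N) 0 q := lt_of_lt_of_le hc hB
  have hdiff := DeltaXir_sub_le hN hR hq
  rw [inv_sub_inv hA0.ne' hB0.ne', abs_div, abs_of_pos (mul_pos hA0 hB0), ← abs_neg, neg_sub,
    div_le_iff₀ (mul_pos hA0 hB0)]
  have hS0 : 0 ≤ (∑ ν, |q ν|) / N := by positivity
  calc |DeltaXir N 0 q - DeltaXir (R * N) 0 q|
      ≤ Real.pi / 12 * ((∑ ν, |q ν|) / N) * momSq q := hdiff
    _ = Real.pi ^ 3 / 48 * ((∑ ν, |q ν|) / N) * (Real.pi ^ 2 / 4 / momSq q)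
          * ((4 / Real.pi ^ 2 * momSq q) * (4 / Real.pi ^ 2 * momSq q)) := by
        field_simp; ring
    _ ≤ Real.pi ^ 3 / 48 * ((∑ ν, |q ν|) / N) * (Real.pi ^ 2 / 4 / momSq q)
          * (DeltaXir N 0 q * DeltaXir (R * N) 0 q) := by gcongr

/-! ### King's one-coordinate leaves at `η = 1/n` -/

/-- `‖e^{−ix} − 1‖² = S₁(x)`. [folklore] -/
theorem norm_cexp_negI_sub_one_sq (x : ℝ) : ‖Complex.exp (I * ((-x : ℝ) : ℂ)) - 1‖ ^ 2 = S1r x := by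
  rw [show I * ((-x : ℝ) : ℂ) = ((-x : ℝ) : ℂ) * I by ring, norm_exp_mul_I_sub_one_sq]
  unfold S1r; rw [Real.cos_neg]

/-- `‖D_{1/n}(x)‖² = S_{1/n}(x)` (`= 4n² sin²(x/2n)`). [folklore] -/
theorem norm_fdq_sq {n : ℕ} (hn : 1 ≤ n) (x : ℝ) : ‖fdq ((n : ℝ)⁻¹) x‖ ^ 2 = Sxir n x := by
  have hn' : (0 : ℝ) < n := by exact_mod_cast hn
  unfold King1986.fdq
  rw [norm_div, div_pow, Complex.norm_real, Real.norm_eq_abs, abs_of_pos (inv_pos.mpr hn'),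
    show -((n : ℝ)⁻¹ * x) = -(x / n) by field_simp, norm_cexp_negI_sub_one_sq]
  unfold S1r Sxir
  field_simp

/-- `‖f_{1/n}(x)‖ ≤ 1` on the fine zone — at the spacings `η = 1/n` King's factor is a mean of `n` unimodular
numbers (`S₁(x) ≤ S_{1/n}(x)`, tree `B5Prop11Leaves.S1r_le_Sxir`). [folklore] -/
theorem norm_uFac_le_one {n : ℕ} (hn : 1 ≤ n) {x : ℝ} (hx : |x| ≤ Real.pi * n) :
    ‖uFac ((n : ℝ)⁻¹) x‖ ≤ 1 := by
  rcases eq_or_ne x 0 with hx0 | hx0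
  · subst hx0; simp [King1986.uFac]
  have hn' : (0 : ℝ) < n := by exact_mod_cast hn
  have hη : (0 : ℝ) < (n : ℝ)⁻¹ := inv_pos.mpr hn'
  have hz : |(n : ℝ)⁻¹ * x| ≤ Real.pi := by
    rw [abs_mul, abs_inv, abs_of_pos hn', inv_mul_le_iff₀ hn']; linarith
  have hD : fdq ((n : ℝ)⁻¹) x ≠ 0 := King1986.fdq_ne_zero hη hx0 hz
  unfold King1986.uFac
  rw [if_neg hx0, norm_div, div_le_one (norm_pos_iff.mpr hD)]
  have h1 := norm_cexp_negI_sub_one_sq x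
  have h2 := norm_fdq_sq hn x
  have h3 := S1r_le_Sxir n hn x
  nlinarith [norm_nonneg (Complex.exp (I * ((-x : ℝ) : ℂ)) - 1), norm_nonneg (fdq ((n : ℝ)⁻¹) x)]

/-- King's (4.20)-type bound for one factor at an ALIASED coordinate: if `q = s + 2πm`, `m ∈ ℤ`, `q ≠ s`
(so `|q| ≥ π`), `|s| ≤ π` and `|q| ≤ πn`, then `‖f_{1/n}(q)‖ ≤ (π/2)|s|/|q|`.
[cite: King1986, (4.20) p.672] [folklore] -/
theorem norm_uFac_le_alias {n : ℕ} (hn : 1 ≤ n) {x s : ℝ} (m : ℤ) (hm : x = s + 2 * Real.pi * m)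
    (hxs : x ≠ s) (hs : |s| ≤ Real.pi) (hx : |x| ≤ Real.pi * n) :
    ‖uFac ((n : ℝ)⁻¹) x‖ ≤ Real.pi / 2 * |s| / |x| := by
  have hπ := Real.pi_pos
  have hn' : (0 : ℝ) < n := by exact_mod_cast hn
  have hη : (0 : ℝ) < (n : ℝ)⁻¹ := inv_pos.mpr hn'
  have hm0 : m ≠ 0 := by rintro rfl; simp at hm; exact hxs hm
  have hxπ : Real.pi ≤ |x| := by
    have hm1 : (1 : ℝ) ≤ |(m : ℝ)| := by rw [← Int.cast_abs]; exact_mod_cast Int.one_le_abs hm0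
    have h2 : |2 * Real.pi * (m : ℝ)| = 2 * Real.pi * |(m : ℝ)| := by
      rw [abs_mul, abs_of_pos (by positivity)]
    have h3 : |2 * Real.pi * (m : ℝ)| ≤ |x| + |s| := by
      have := abs_add_le x (-s); rw [abs_neg] at this
      have e : x + -s = 2 * Real.pi * m := by rw [hm]; ring
      rw [e] at this; exact this
    nlinarith
  have hx0 : x ≠ 0 := by intro h; rw [h, abs_zero] at hxπ; linarith
  have hz : |(n : ℝ)⁻¹ * x| ≤ Real.pi := by
    rw [abs_mul, abs_inv, abs_of_pos hn', inv_mul_le_iff₀ hn']; linarith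
  have hD : fdq ((n : ℝ)⁻¹) x ≠ 0 := King1986.fdq_ne_zero hη hx0 hz
  have hDge := King1986.norm_fdq_ge hη hz
  have hDpos : 0 < ‖fdq ((n : ℝ)⁻¹) x‖ := norm_pos_iff.mpr hD
  unfold King1986.uFac
  rw [if_neg hx0, norm_div, div_le_iff₀ hDpos]
  -- numerator: the phase of `x` equals the phase of `s`
  have hnum : ‖Complex.exp (I * ((-x : ℝ) : ℂ)) - 1‖ ≤ |s| := by
    have e : Complex.exp (I * ((-x : ℝ) : ℂ)) = Complex.exp (I * ((-s : ℝ) : ℂ)) := by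
      have h1 : (-x) = (-s) + 2 * Real.pi * ((-m : ℤ) : ℝ) := by rw [hm]; push_cast; ring
      rw [h1]; push_cast
      rw [show I * (-(s : ℂ) + 2 * (Real.pi : ℂ) * -(m : ℂ)) = I * (-(s : ℂ)) + ((-m : ℤ) : ℂ) * (2 * Real.pi * I) by
        push_cast; ring, Complex.exp_add, Complex.exp_int_mul_two_pi_mul_I, mul_one]
    rw [e]
    have := Real.norm_exp_I_mul_ofReal_sub_one_le (x := -s)
    rw [Real.norm_eq_abs, abs_neg] at this
    exact this
  have hxpos : 0 < |x| := abs_pos.mpr hx0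
  calc ‖Complex.exp (I * ((-x : ℝ) : ℂ)) - 1‖ ≤ |s| := hnum
    _ = Real.pi / 2 * |s| / |x| * (2 / Real.pi * |x|) := by field_simp
    _ ≤ Real.pi / 2 * |s| / |x| * ‖fdq ((n : ℝ)⁻¹) x‖ := by gcongr

/-- `‖D_η(x)‖ ≤ |x|` restated at `η = 1/n`. [folklore] -/
theorem norm_fdq_le' {n : ℕ} (hn : 1 ≤ n) (x : ℝ) : ‖fdq ((n : ℝ)⁻¹) x‖ ≤ |x| :=
  King1986.norm_fdq_le (inv_pos.mpr (by exact_mod_cast hn)) x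

/-- `‖conj (e^{is} − 1)‖ ≤ |s|`. [folklore] -/
theorem norm_conj_d1Sym_le (s : Fin d → ℝ) (μ : Fin d) : ‖conj (d1Sym s μ)‖ ≤ |s μ| := by
  rw [Complex.norm_conj]; unfold d1Sym
  have := Real.norm_exp_I_mul_ofReal_sub_one_le (x := s μ)
  rw [Real.norm_eq_abs, show I * ((s μ : ℝ) : ℂ) = ((s μ : ℝ) : ℂ) * I by ring] at this
  exact this

/-! ### refinement rates of King's leaves between the levels `N` and `R·N` -/

section LeafRates
variable {N R : ℕ}

/-- `|1/N − 1/(RN)| ≤ 1/N`. [folklore] -/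
theorem eta_sub_le (hN : 1 ≤ N) (hR : 1 ≤ R) : |(N : ℝ)⁻¹ - ((R * N : ℕ) : ℝ)⁻¹| ≤ (N : ℝ)⁻¹ := by
  have hN' : (0 : ℝ) < N := by exact_mod_cast hN
  have hRN : (N : ℝ) ≤ (R * N : ℕ) := by
    have h1 : (1 : ℝ) ≤ R := by exact_mod_cast hR
    push_cast; nlinarith
  have h1 : ((R * N : ℕ) : ℝ)⁻¹ ≤ (N : ℝ)⁻¹ := inv_anti₀ hN' hRN
  have h2 : (0 : ℝ) ≤ ((R * N : ℕ) : ℝ)⁻¹ := by positivity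
  rw [abs_of_nonneg (by linarith)]; linarith

/-- the level-`N` fine zone lies inside the level-`RN` one. [folklore] -/
theorem zone_RN (hR : 1 ≤ R) {x : ℝ} (hx : |x| ≤ Real.pi * N) : |x| ≤ Real.pi * (R * N : ℕ) := by
  have h1 : (1 : ℝ) ≤ R := by exact_mod_cast hR
  have hπ := Real.pi_pos
  push_cast; nlinarith [abs_nonneg x, (show (0 : ℝ) ≤ N by positivity)]

/-- `|η x| ≤ π` on the fine zone `|x| ≤ πn`, `η = 1/n`. [folklore] -/
theorem zone_eta {n : ℕ} (hn : 1 ≤ n) {x : ℝ} (hx : |x| ≤ Real.pi * n) : |(n : ℝ)⁻¹ * x| ≤ Real.pi := by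
  have hn' : (0 : ℝ) < n := by exact_mod_cast hn
  rw [abs_mul, abs_inv, abs_of_pos hn', inv_mul_le_iff₀ hn']; linarith

/-- (R1) `‖ū_N(q) − ū_{RN}(q)‖ ≤ (π/2)^{d+1}·(|q|₁/N)·‖ū_N(q)‖`. [cite: King1986, Lemma 4.4 (4.29) p.673] [folklore] -/
theorem uWeight_rate (hN : 1 ≤ N) (hR : 1 ≤ R) {q : Fin d → ℝ} (hq : ∀ ν, |q ν| ≤ Real.pi * N) :
    ‖uWeight ((N : ℝ)⁻¹) q - uWeight (((R * N : ℕ) : ℝ)⁻¹) q‖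
      ≤ (Real.pi / 2) ^ (d + 1) * ((∑ ν, |q ν|) / N) * ‖uWeight ((N : ℝ)⁻¹) q‖ := by
  have hN' : (0 : ℝ) < N := by exact_mod_cast hN
  have hRN1 : 1 ≤ R * N := Nat.one_le_iff_ne_zero.mpr (Nat.mul_ne_zero (by omega) (by omega))
  have hRN' : (0 : ℝ) < (R * N : ℕ) := by exact_mod_cast hRN1
  have h := King1986.lemma44 (d := d) (inv_pos.mpr hN') (inv_pos.mpr hRN') (p := q)
    (fun ν => zone_eta hN (hq ν)) (fun ν => zone_eta hRN1 (zone_RN hR (hq ν)))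
  refine h.trans ?_
  have hε := eta_sub_le hN hR
  have hS0 : 0 ≤ ∑ ν, |q ν| := sum_nonneg fun ν _ => abs_nonneg _
  have hu0 := norm_nonneg (uWeight ((N : ℝ)⁻¹) q)
  have hπ2 : 0 ≤ Real.pi / 2 := by positivity
  calc (Real.pi / 2) ^ d * (∑ ν, Real.pi / 2 * |(N : ℝ)⁻¹ - ((R * N : ℕ) : ℝ)⁻¹| * |q ν|)
          * ‖uWeight ((N : ℝ)⁻¹) q‖
      = (Real.pi / 2) ^ (d + 1) * |(N : ℝ)⁻¹ - ((R * N : ℕ) : ℝ)⁻¹| * (∑ ν, |q ν|)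
          * ‖uWeight ((N : ℝ)⁻¹) q‖ := by rw [← Finset.mul_sum]; ring
    _ ≤ (Real.pi / 2) ^ (d + 1) * (N : ℝ)⁻¹ * (∑ ν, |q ν|) * ‖uWeight ((N : ℝ)⁻¹) q‖ := by gcongr
    _ = (Real.pi / 2) ^ (d + 1) * ((∑ ν, |q ν|) / N) * ‖uWeight ((N : ℝ)⁻¹) q‖ := by
        rw [div_eq_mul_inv]; ring

/-- (R2) one factor: `‖f_N(x) − f_{RN}(x)‖ ≤ (π/2)(|x|/N)‖f_N(x)‖`. [cite: King1986, (4.29)–(4.30) p.673] [folklore] -/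
theorem uFac_rate (hN : 1 ≤ N) (hR : 1 ≤ R) {x : ℝ} (hx : |x| ≤ Real.pi * N) :
    ‖uFac ((N : ℝ)⁻¹) x - uFac (((R * N : ℕ) : ℝ)⁻¹) x‖ ≤ Real.pi / 2 * (|x| / N) * ‖uFac ((N : ℝ)⁻¹) x‖ := by
  have hN' : (0 : ℝ) < N := by exact_mod_cast hN
  have hRN1 : 1 ≤ R * N := Nat.one_le_iff_ne_zero.mpr (Nat.mul_ne_zero (by omega) (by omega))
  have hRN' : (0 : ℝ) < (R * N : ℕ) := by exact_mod_cast hRN1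
  have h := King1986.norm_uFac_sub_uFac_le (inv_pos.mpr hN') (inv_pos.mpr hRN') (zone_eta hN hx)
    (zone_eta hRN1 (zone_RN hR hx))
  refine h.trans ?_
  have hε := eta_sub_le hN hR
  have hu0 := norm_nonneg (uFac ((N : ℝ)⁻¹) x)
  calc Real.pi / 2 * |(N : ℝ)⁻¹ - ((R * N : ℕ) : ℝ)⁻¹| * |x| * ‖uFac ((N : ℝ)⁻¹) x‖
      ≤ Real.pi / 2 * (N : ℝ)⁻¹ * |x| * ‖uFac ((N : ℝ)⁻¹) x‖ := by gcongr
    _ = Real.pi / 2 * (|x| / N) * ‖uFac ((N : ℝ)⁻¹) x‖ := by rw [div_eq_mul_inv]; ring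

/-- (R3) `‖D_N(x) − D_{RN}(x)‖ ≤ (|x|/N)·|x|` (the sharp constant is `1/2`; `1` suffices here).
[cite: King1986, (4.25) p.673] [folklore] -/
theorem fdq_rate (hN : 1 ≤ N) (hR : 1 ≤ R) (x : ℝ) :
    ‖fdq ((N : ℝ)⁻¹) x - fdq (((R * N : ℕ) : ℝ)⁻¹) x‖ ≤ |x| / N * |x| := by
  have hN' : (0 : ℝ) < N := by exact_mod_cast hN
  have hRN1 : 1 ≤ R * N := Nat.one_le_iff_ne_zero.mpr (Nat.mul_ne_zero (by omega) (by omega))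
  have hRN' : (0 : ℝ) < (R * N : ℕ) := by exact_mod_cast hRN1
  have h := King1986.norm_fdq_sub_fdq_le (inv_pos.mpr hRN') (inv_pos.mpr hN') x
  -- h : ‖fdq (1/N) x - fdq (1/RN) x‖ ≤ |1/RN - 1/N| * x^2
  refine h.trans ?_
  have hε := eta_sub_le hN hR
  rw [abs_sub_comm] at hε
  calc |((R * N : ℕ) : ℝ)⁻¹ - (N : ℝ)⁻¹| * x ^ 2 ≤ (N : ℝ)⁻¹ * x ^ 2 := by gcongr
    _ = |x| / N * |x| := by rw [← sq_abs, div_eq_mul_inv]; ring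

/-- (R9) `|‖f_N(x)‖² − ‖f_{RN}(x)‖²| ≤ π(|x|/N)‖f_N(x)‖` on the zone. [folklore] -/
theorem normSq_uFac_rate (hN : 1 ≤ N) (hR : 1 ≤ R) {x : ℝ} (hx : |x| ≤ Real.pi * N) :
    |‖uFac ((N : ℝ)⁻¹) x‖ ^ 2 - ‖uFac (((R * N : ℕ) : ℝ)⁻¹) x‖ ^ 2| ≤ Real.pi * (|x| / N) * ‖uFac ((N : ℝ)⁻¹) x‖ := by
  have hRN1 : 1 ≤ R * N := Nat.one_le_iff_ne_zero.mpr (Nat.mul_ne_zero (by omega) (by omega))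
  set a := uFac ((N : ℝ)⁻¹) x
  set b := uFac (((R * N : ℕ) : ℝ)⁻¹) x
  have ha : ‖a‖ ≤ 1 := norm_uFac_le_one hN hx
  have hb : ‖b‖ ≤ 1 := norm_uFac_le_one hRN1 (zone_RN hR hx)
  have hr : ‖a - b‖ ≤ Real.pi / 2 * (|x| / N) * ‖a‖ := uFac_rate hN hR hx
  have h1 : |‖a‖ - ‖b‖| ≤ ‖a - b‖ := abs_norm_sub_norm_le a b
  rw [sq_sub_sq, abs_mul]
  have h2 : |‖a‖ + ‖b‖| ≤ 2 := by rw [abs_of_nonneg (by positivity)]; linarith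
  have h0 : 0 ≤ Real.pi / 2 * (|x| / N) * ‖a‖ := by positivity
  calc |‖a‖ + ‖b‖| * |‖a‖ - ‖b‖| ≤ 2 * (Real.pi / 2 * (|x| / N) * ‖a‖) := by
        gcongr; exact h1.trans hr
    _ = Real.pi * (|x| / N) * ‖a‖ := by ring

end LeafRates


/-! ## §1 The multiplier of (1.63) as a function of the PHYSICAL fine momentum `q = p′ + l` and the level `n` -/

/-- `E₁^{(n)}(p′) := Σ_κ S₁(p′_κ)/φ_κ^{(n)}(p′)` (`= Δ₀(p′)²·N(p′)`, `N` the inverted direction sum of (1.63),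
`B5Symbol163.nSym`). [folklore] -/
def E1 (n : ℕ) (s : Fin d → ℝ) : ℝ := ∑ κ, S1r (s κ) / phi162 n κ s

/-- **The (1.63) multiplier in physical variables.**  For a level `n` (`η = 1/n`), directions `μ, λ`, a fine
momentum `q ∈ ℝ^d` (the alias `p′ + l`, ANY real representative) and the reduced momentum `p′ = s`:
`h^{(n)}_{μλ}(q; p′) = δ_{μλ}· ū(q) v̄_μ(q_μ) / (Δ^{(n)}(q) φ_μ^{(n)}(p′))`
`  + ∂_μ(q_μ) ū(q) Δ^{(n)}(q)⁻¹ · (φ_μ^{(n)}(p′)/(Δ^{(n)}(q) ψ^{(n)}(p′)) − |v_μ(q_μ)|²) · conj ∂¹_λ(p′) / (φ_μ φ_λ E₁)(p′)`,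
with King's typed fine leaves `ū = King1986.uWeight η q`, `v̄_μ = King1986.uFac η q_μ`, `∂_μ = conj (King1986.fdq η q_μ)`,
`Δ^{(n)}(q) = B4Strip.DeltaXir n 0 q`, and the level-`n` alias sums `φ_ν = B5Bounds167Lattice.phi162 n ν p′`,
`ψ = B5ActionRate166.psiSum n p′`.  On the torus leaves it IS `B5Hk163Strip.h163` (`h163_ofReal_eq_hPhys`).
[cite: Balaban1984PropagatorsI, (1.63) p.28 (text of the formula only; the regrouping is ours)] [folklore] -/
def hPhys (n : ℕ) (μ lam : Fin d) (q s : Fin d → ℝ) : ℂ :=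
  (if lam = μ then
      uWeight ((n : ℝ)⁻¹) q * uFac ((n : ℝ)⁻¹) (q μ)
        / (((DeltaXir n 0 q : ℝ) : ℂ) * ((phi162 n μ s : ℝ) : ℂ))
    else 0)
  + conj (fdq ((n : ℝ)⁻¹) (q μ)) * uWeight ((n : ℝ)⁻¹) q / ((DeltaXir n 0 q : ℝ) : ℂ)
      * (((phi162 n μ s : ℝ) : ℂ) / (((DeltaXir n 0 q : ℝ) : ℂ) * ((psiSum n s : ℝ) : ℂ))
          - (((‖uFac ((n : ℝ)⁻¹) (q μ)‖ ^ 2 : ℝ) : ℂ)))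
      * conj (d1Sym s lam)
      / (((phi162 n μ s : ℝ) : ℂ) * ((phi162 n lam s : ℝ) : ℂ) * ((E1 n s : ℝ) : ℂ))

/-! ## §2 Bridges: the torus leaves of `B5Prop11Fiber` at the alias index `k` ARE King's leaves at any real
representative `q ≡ p′ + 2πk (mod 2πn)` of the physical momentum lying in the fine zone `|q_ν| ≤ πn` -/

section Bridges

variable (n : ℕ) [NeZero n]

/-- phases agree on congruent real arguments: `e^{ia} = e^{ib}` for `a − b ∈ 2πℤ`. [folklore] -/
theorem cexp_mul_I_eq_of_sub_eq (a b : ℝ) (m : ℤ) (h : a = b + 2 * Real.pi * m) :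
    Complex.exp ((a : ℂ) * I) = Complex.exp ((b : ℂ) * I) := by
  rw [h]
  push_cast
  rw [show ((b : ℂ) + 2 * (Real.pi : ℂ) * (m : ℂ)) * I = (b : ℂ) * I + (m : ℂ) * (2 * Real.pi * I) by ring,
    Complex.exp_add, Complex.exp_int_mul_two_pi_mul_I, mul_one]

/-- idem with `−I`. [folklore] -/
theorem cexp_mul_negI_eq_of_sub_eq (a b : ℝ) (m : ℤ) (h : a = b + 2 * Real.pi * m) :
    Complex.exp (-((a : ℂ) * I)) = Complex.exp (-((b : ℂ) * I)) := by
  have := cexp_mul_I_eq_of_sub_eq (-a) (-b) (-m) (by rw [h]; push_cast; ring)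
  push_cast at this
  simpa [neg_mul] using this

variable {n}

/-- hypotheses of the bridge: `q` is a real representative of the alias `p′ + 2πk` modulo `2πn` lying in the
fine zone. [folklore] -/
structure IsRep (n : ℕ) (k : Fin d → Fin n) (s q : Fin d → ℝ) : Prop where
  rep : ∀ ν, ∃ j : ℕ, shiftr n k s ν = q ν + 2 * Real.pi * ((n * j : ℕ) : ℝ)
  zone : ∀ ν, |q ν| ≤ Real.pi * n

omit [NeZero n] in
/-- a representative differs from `p′_ν` by `2π ×` an integer. [folklore] -/
theorem IsRep.exists_int {k : Fin d → Fin n} {s q : Fin d → ℝ} (h : IsRep n k s q) (ν : Fin d) :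
    ∃ m : ℤ, q ν = s ν + 2 * Real.pi * m := by
  obtain ⟨j, hj⟩ := h.rep ν
  refine ⟨(k ν : ℕ) - (n * j : ℕ), ?_⟩
  have : q ν = shiftr n k s ν - 2 * Real.pi * ((n * j : ℕ) : ℝ) := by linarith
  rw [this]
  unfold shiftr
  push_cast
  ring

omit [NeZero n] in
/-- in the zone, a representative vanishes exactly where the uncentred one does. [folklore] -/
theorem IsRep.eq_zero_iff (hn : 1 ≤ n) {k : Fin d → Fin n} {s q : Fin d → ℝ} (h : IsRep n k s q)
    (hs : ∀ ν, |s ν| ≤ Real.pi) (ν : Fin d) : q ν = 0 ↔ shiftr n k s ν = 0 := by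
  obtain ⟨j, hj⟩ := h.rep ν
  have hz := h.zone ν
  obtain ⟨hlo, hhi⟩ := King1986.shiftr_mem k hs ν
  have hπ := Real.pi_pos
  have hn' : (1 : ℝ) ≤ n := by exact_mod_cast hn
  rcases Nat.eq_zero_or_pos j with hj0 | hjpos
  · subst hj0; simp at hj; rw [hj]
  · -- `j ≥ 1`: then `shiftr = q + 2πnj ≥ πn > 0` and `q = shiftr − 2πnj < 0`
    have hj1 : (1 : ℝ) ≤ j := by exact_mod_cast hjpos
    have hnj : (n : ℝ) * 1 ≤ (n : ℝ) * j := by nlinarith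
    push_cast at hj
    have hq := (abs_le.mp hz).1
    constructor
    · intro hq0; exfalso; rw [hq0] at hj; nlinarith
    · intro hsh; exfalso; rw [hsh] at hj; nlinarith

omit [NeZero n] in
/-- **bridge 1**: the shifted symbol `Δ(p′+l)` is King's `Δ^{(n)}` at the representative. [folklore] -/
theorem IsRep.DeltaXir_eq (hn : 1 ≤ n) {k : Fin d → Fin n} {s q : Fin d → ℝ} (h : IsRep n k s q) :
    DeltaXir n 0 (shiftr n k s) = DeltaXir n 0 q := by
  unfold DeltaXir
  congr 1
  refine Finset.sum_congr rfl fun ν _ => ?_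
  obtain ⟨j, hj⟩ := h.rep ν
  rw [hj, King1986.Sxir_add_two_pi_mul_nat (by omega) (q ν) j]

omit [NeZero n] in
/-- **bridge 2**: `∂_μ(p′+l) = conj D_η(q_μ)`, `D_η = King1986.fdq`. [folklore] -/
theorem IsRep.dSym_eq (hn : 1 ≤ n) {k : Fin d → Fin n} {s q : Fin d → ℝ} (h : IsRep n k s q) (μ : Fin d) :
    dSym n k s μ = conj (fdq ((n : ℝ)⁻¹) (q μ)) := by
  obtain ⟨j, hj⟩ := h.rep μ
  have hn0 : (n : ℝ) ≠ 0 := by exact_mod_cast (show n ≠ 0 by omega)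
  unfold dSym King1986.fdq
  have hphase : Complex.exp (((shiftr n k s μ / n : ℝ) : ℂ) * I) = Complex.exp (((q μ / n : ℝ) : ℂ) * I) := by
    refine cexp_mul_I_eq_of_sub_eq _ _ (j : ℤ) ?_
    rw [hj]; push_cast; field_simp
  rw [hphase, map_div₀, map_sub, map_one, ← Complex.exp_conj, Complex.conj_ofReal]
  have : conj (I * ((-((n : ℝ)⁻¹ * q μ) : ℝ) : ℂ)) = ((q μ / n : ℝ) : ℂ) * I := by
    rw [map_mul, Complex.conj_I, Complex.conj_ofReal]; push_cast; field_simp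
  rw [this]
  push_cast
  field_simp

/-- **bridge 3**: `conj v_μ(p′+l) = f_η(q_μ)`, `f_η = King1986.uFac` (removable singularities match in the zone).
[folklore] -/
theorem IsRep.conj_vSym_eq (hn : 1 ≤ n) {k : Fin d → Fin n} {s q : Fin d → ℝ} (h : IsRep n k s q)
    (hs : ∀ ν, |s ν| ≤ Real.pi) (μ : Fin d) :
    conj (vSym n k s μ) = uFac ((n : ℝ)⁻¹) (q μ) := by
  have hzero : dSym n k s μ = 0 ↔ q μ = 0 := by
    rw [dSym_eq_zero_iff n hn k s μ (hs μ), h.eq_zero_iff hn hs μ]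
    unfold shiftr
    constructor
    · rintro ⟨h1, h2⟩; rw [h1, h2]; simp
    · intro hsh
      have hπ := Real.pi_pos
      have hk0 : (0 : ℝ) ≤ ((k μ : ℕ) : ℝ) := by positivity
      have hsμ := abs_le.mp (hs μ)
      -- `s_μ + 2πk_μ = 0` with `|s_μ| ≤ π` forces `k_μ = 0` (else `≥ 2π − π > 0`) and then `s_μ = 0`
      have hk : (k μ : ℕ) = 0 := by
        by_contra hne
        have : (1 : ℝ) ≤ ((k μ : ℕ) : ℝ) := by exact_mod_cast Nat.one_le_iff_ne_zero.mpr hne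
        nlinarith
      refine ⟨?_, Fin.ext (by simpa using hk)⟩
      rw [hk] at hsh; simpa using hsh
  unfold vSym King1986.uFac
  by_cases hq : q μ = 0
  · rw [if_pos (hzero.mpr hq), if_pos hq, map_one]
  · rw [if_neg (mt hzero.mp hq), if_neg hq, map_div₀, h.dSym_eq hn μ, Complex.conj_conj]
    congr 1
    -- numerators: `conj (e^{ip′_μ} − 1) = e^{−iq_μ} − 1`
    obtain ⟨m, hm⟩ := h.exists_int μ
    unfold d1Sym
    rw [map_sub, map_one, ← Complex.exp_conj, map_mul, Complex.conj_ofReal, Complex.conj_I]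
    have e := cexp_mul_negI_eq_of_sub_eq (q μ) (s μ) m hm
    rw [show I * (((-q μ : ℝ)) : ℂ) = -(((q μ : ℝ) : ℂ) * I) by push_cast; ring, e,
      show ((s μ : ℝ) : ℂ) * -I = -(((s μ : ℝ) : ℂ) * I) by ring]

/-- **bridge 4**: `conj u(p′+l) = u^η(q)`, King's averaging weight (4.3) (`King1986.uWeight`). [folklore] -/
theorem IsRep.conj_uSym_eq (hn : 1 ≤ n) {k : Fin d → Fin n} {s q : Fin d → ℝ} (h : IsRep n k s q)
    (hs : ∀ ν, |s ν| ≤ Real.pi) :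
    conj (uSym n k s) = uWeight ((n : ℝ)⁻¹) q := by
  unfold uSym King1986.uWeight
  rw [map_prod]
  exact Finset.prod_congr rfl fun μ _ => h.conj_vSym_eq hn hs μ

/-- **bridge 5**: `|v_μ(p′+l)|² = ‖f_η(q_μ)‖²`. [folklore] -/
theorem IsRep.normSq_vSym_eq (hn : 1 ≤ n) {k : Fin d → Fin n} {s q : Fin d → ℝ} (h : IsRep n k s q)
    (hs : ∀ ν, |s ν| ≤ Real.pi) (μ : Fin d) :
    Complex.normSq (vSym n k s μ) = ‖uFac ((n : ℝ)⁻¹) (q μ)‖ ^ 2 := by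
  rw [Complex.normSq_eq_norm_sq, ← h.conj_vSym_eq hn hs μ, Complex.norm_conj]

/-- `S = Σ_{l′}|u(p′+l′)|²Δ₀²/Δ²(p′+l′) = Δ₀² · psiSum n p′` on the torus leaves. [folklore] -/
theorem sSym_ofReal_psiSum (hn : 1 ≤ n) (s : Fin d → ℝ) (hs : ∀ ν, |s ν| ≤ Real.pi) :
    sSym (fun l : Fin d → Fin n => uSym n l s) (fun l => ((DeltaXir n 0 (shiftr n l s) : ℝ) : ℂ))
        ((Delta1r 0 s : ℝ) : ℂ)
      = (((Delta1r 0 s ^ 2 * psiSum n s : ℝ)) : ℂ) := by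
  unfold sSym B5ActionRate166.psiSum
  push_cast
  rw [Finset.mul_sum]
  refine Finset.sum_congr rfl fun l _ => ?_
  rw [Complex.normSq_eq_norm_sq, norm_uSym_sq n hn l s hs]
  ring

omit [NeZero n] in
/-- `N = E₁/Δ₀²` on the torus leaves. [folklore] -/
theorem nSym_ofReal_E1 (s : Fin d → ℝ) :
    nSym (d1Sym s) (fun ν => ((phi162 n ν s : ℝ) : ℂ)) ((Delta1r 0 s : ℝ) : ℂ)
      = ((E1 n s : ℝ) : ℂ) / ((Delta1r 0 s : ℝ) : ℂ) ^ 2 := by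
  unfold nSym E1
  push_cast
  rw [Finset.sum_div]
  refine Finset.sum_congr rfl fun ν _ => ?_
  rw [Complex.normSq_eq_norm_sq, norm_d1Sym_sq]
  ring


/-! ### positivity of the level-`n` alias sums on the punctured zone -/

/-- `φ_μ(p′) > 0` on the punctured zone (from `B5Bounds167Lattice.Delta0_phi162_lower`). [folklore] -/
theorem phi162_pos' (hn : 1 ≤ n) (μ : Fin d) (s : Fin d → ℝ) (hs : ∀ ν, |s ν| ≤ Real.pi) (ν₀ : Fin d)
    (hν₀ : s ν₀ ≠ 0) : 0 < phi162 n μ s := by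
  have h := B5Bounds167Lattice.Delta0_phi162_lower n hn μ s hs ν₀ hν₀
  have hΔ : 0 < Delta1r 0 s := Delta1r_pos s hs ν₀ hν₀
  have hc : 0 < (4 / Real.pi ^ 2) ^ (d + 2) := by positivity
  by_contra hle; push Not at hle
  have : Delta1r 0 s * phi162 n μ s ≤ 0 := mul_nonpos_of_nonneg_of_nonpos hΔ.le hle
  linarith

/-- `ψ(p′) ≥ γ₀/Δ₀(p′)²` on the punctured zone (`γ₀ = (4/π²)^{d+2}`). [folklore] -/
theorem psiSum_lower (hn : 1 ≤ n) (s : Fin d → ℝ) (hs : ∀ ν, |s ν| ≤ Real.pi) (ν₀ : Fin d)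
    (hν₀ : s ν₀ ≠ 0) : T4GaugeActionRate.gam0 d / Delta1r 0 s ^ 2 ≤ psiSum n s := by
  have hΔ : 0 < Delta1r 0 s := Delta1r_pos s hs ν₀ hν₀
  have hD : 0 < DeltaXir n 0 s := DeltaXir_pos n hn s hs ν₀ hν₀
  have hDle : DeltaXir n 0 s ≤ Real.pi ^ 2 / 4 * Delta1r 0 s := DeltaXir_le_Delta1r n s hs
  have hπ := Real.pi_pos
  unfold B5ActionRate166.psiSum
  have h0 : T4GaugeActionRate.gam0 d / Delta1r 0 s ^ 2
      ≤ Ur n (fun _ => (0 : Fin n)) s / DeltaXir n 0 (shiftr n (fun _ => (0 : Fin n)) s) ^ 2 := by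
    rw [shiftr_zero]
    have hU := Ur_zero_ge n hn s hs
    have hc : 0 ≤ (4 / Real.pi ^ 2) ^ d := by positivity
    have hkey : 4 / Real.pi ^ 2 * DeltaXir n 0 s ≤ Delta1r 0 s := by
      rw [div_mul_eq_mul_div, div_le_iff₀ (by positivity)]; nlinarith
    calc T4GaugeActionRate.gam0 d / Delta1r 0 s ^ 2
        ≤ (4 / Real.pi ^ 2) ^ d / DeltaXir n 0 s ^ 2 := by
          rw [div_le_div_iff₀ (by positivity) (by positivity)]
          unfold T4GaugeActionRate.gam0
          calc (4 / Real.pi ^ 2) ^ (d + 2) * DeltaXir n 0 s ^ 2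
              = (4 / Real.pi ^ 2) ^ d * (4 / Real.pi ^ 2 * DeltaXir n 0 s) ^ 2 := by ring
            _ ≤ (4 / Real.pi ^ 2) ^ d * Delta1r 0 s ^ 2 := by gcongr
      _ ≤ Ur n (fun _ => (0 : Fin n)) s / DeltaXir n 0 s ^ 2 := by gcongr
  refine h0.trans ?_
  exact Finset.single_le_sum (f := fun l : Fin d → Fin n => Ur n l s / DeltaXir n 0 (shiftr n l s) ^ 2)
    (fun l _ => div_nonneg (Ur_nonneg n l s) (sq_nonneg _)) (Finset.mem_univ _)

/-- `ψ(p′) > 0` on the punctured zone. [folklore] -/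
theorem psiSum_pos (hn : 1 ≤ n) (s : Fin d → ℝ) (hs : ∀ ν, |s ν| ≤ Real.pi) (ν₀ : Fin d)
    (hν₀ : s ν₀ ≠ 0) : 0 < psiSum n s := by
  have hΔ : 0 < Delta1r 0 s := Delta1r_pos s hs ν₀ hν₀
  have hg := T4GaugeActionRate.gam0_pos d
  have : 0 < T4GaugeActionRate.gam0 d / Delta1r 0 s ^ 2 := by positivity
  exact this.trans_le (psiSum_lower hn s hs ν₀ hν₀)

/-- `Δ₀² ≤ E₁ ≤ Δ₀²/γ₀`-type bounds: we need `Δ₀(p′)² ≤ E₁^{(n)}(p′)` (from `Δ₀φ_κ ≤ 1`). [folklore] -/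
theorem E1_lower (hn : 1 ≤ n) (s : Fin d → ℝ) (hs : ∀ ν, |s ν| ≤ Real.pi) (ν₀ : Fin d) (hν₀ : s ν₀ ≠ 0) :
    Delta1r 0 s ^ 2 ≤ E1 n s := by
  have hΔ : 0 < Delta1r 0 s := Delta1r_pos s hs ν₀ hν₀
  unfold E1
  have hterm : ∀ κ, Delta1r 0 s * S1r (s κ) ≤ S1r (s κ) / phi162 n κ s := by
    intro κ
    have hφ := phi162_pos' hn κ s hs ν₀ hν₀
    have h1 := B5Bounds167Lattice.Delta0_phi162_le_one n hn κ s hs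
    rw [le_div_iff₀ hφ]
    have hS := S1r_nonneg (s κ)
    nlinarith
  calc Delta1r 0 s ^ 2 = ∑ κ, Delta1r 0 s * S1r (s κ) := by
        rw [← Finset.mul_sum]; unfold Delta1r; ring
    _ ≤ ∑ κ, S1r (s κ) / phi162 n κ s := Finset.sum_le_sum fun κ _ => hterm κ

/-- `E(p′) > 0` on the punctured zone. [folklore] -/
theorem E1_pos (hn : 1 ≤ n) (s : Fin d → ℝ) (hs : ∀ ν, |s ν| ≤ Real.pi) (ν₀ : Fin d) (hν₀ : s ν₀ ≠ 0) :
    0 < E1 n s :=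
  (pow_pos (Delta1r_pos s hs ν₀ hν₀) 2).trans_le (E1_lower hn s hs ν₀ hν₀)

omit [NeZero n] in
/-- a representative of an alias has positive fine symbol. [folklore] -/
theorem IsRep.DeltaXir_pos (hn : 1 ≤ n) {k : Fin d → Fin n} {s q : Fin d → ℝ} (h : IsRep n k s q)
    (hs : ∀ ν, |s ν| ≤ Real.pi) (ν₀ : Fin d) (hν₀ : s ν₀ ≠ 0) : 0 < DeltaXir n 0 q := by
  rw [← h.DeltaXir_eq hn]
  exact (Delta1r_pos s hs ν₀ hν₀).trans_le (Delta1r_le_DeltaXir_shift n hn k s)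

/-! ### (1.63) on the torus leaves = `Σ_λ hPhys · B̃_λ` -/

/-- **IDENTIFICATION, printed side.**  On the punctured zone, the printed second expression of (1.63)
(`B5Symbol163.second163` on the torus leaves of `B5Prop11Fiber`, `Δ₀ = Delta1r`, `φ_ν = phi162`) at the alias
index `k` equals `Σ_λ hPhys n μ λ q p′ · B̃_λ` for ANY zone representative `q` of `p′ + 2πk`.
[cite: Balaban1984PropagatorsI, (1.63) p.28 (text of the formula only; the identity is ours)] [folklore] -/
theorem second163_torus_eq_sum_hPhys (hn : 1 ≤ n) (s : Fin d → ℝ) (hs : ∀ ν, |s ν| ≤ Real.pi) (ν₀ : Fin d)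
    (hν₀ : s ν₀ ≠ 0) (μ : Fin d) (k : Fin d → Fin n) (Bt : Fin d → ℂ) {q : Fin d → ℝ} (hq : IsRep n k s q) :
    second163 (fun l : Fin d → Fin n => uSym n l s) (fun l => vSym n l s μ) (fun l => dSym n l s μ)
        (fun l => ((DeltaXir n 0 (shiftr n l s) : ℝ) : ℂ)) ((Delta1r 0 s : ℝ) : ℂ) (d1Sym s)
        (fun ν => ((phi162 n ν s : ℝ) : ℂ)) Bt μ k
      = ∑ lam, hPhys n μ lam q s * Bt lam := by
  have hΔ0 : (Delta1r 0 s : ℝ) ≠ 0 := (Delta1r_pos s hs ν₀ hν₀).ne'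
  have hφ : ∀ ν, (phi162 n ν s : ℝ) ≠ 0 := fun ν => (phi162_pos' hn ν s hs ν₀ hν₀).ne'
  have hψ : (psiSum n s : ℝ) ≠ 0 := (psiSum_pos hn s hs ν₀ hν₀).ne'
  have hE : (E1 n s : ℝ) ≠ 0 := (E1_pos hn s hs ν₀ hν₀).ne'
  have hDq : (DeltaXir n 0 q : ℝ) ≠ 0 := (hq.DeltaXir_pos hn hs ν₀ hν₀).ne'
  have hΔ0' : ((Delta1r 0 s : ℝ) : ℂ) ≠ 0 := by exact_mod_cast hΔ0
  have hφ' : ∀ ν, ((phi162 n ν s : ℝ) : ℂ) ≠ 0 := fun ν => by exact_mod_cast hφ ν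
  have hψ' : ((psiSum n s : ℝ) : ℂ) ≠ 0 := by exact_mod_cast hψ
  have hE' : ((E1 n s : ℝ) : ℂ) ≠ 0 := by exact_mod_cast hE
  have hDq' : ((DeltaXir n 0 q : ℝ) : ℂ) ≠ 0 := by exact_mod_cast hDq
  unfold second163 head163
  rw [sum_erase_eq_sum, sum_second_eq, B5Hk163Strip.phiSym_ofReal n, sSym_ofReal_psiSum hn s hs,
    nSym_ofReal_E1]
  dsimp only
  rw [map_mul, hq.conj_uSym_eq hn hs, hq.conj_vSym_eq hn hs μ, hq.dSym_eq hn μ, hq.DeltaXir_eq hn,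
    hq.normSq_vSym_eq hn hs μ]
  -- distribute the `λ`-sum on the right and compare coefficientwise
  unfold hPhys
  simp only [add_mul, Finset.sum_add_distrib]
  congr 1
  · -- head: only `λ = μ` survives
    simp only [ite_mul, zero_mul, Finset.sum_ite_eq', Finset.mem_univ, if_true]
    field_simp
  · rw [Finset.mul_sum]
    refine Finset.sum_congr rfl fun lam _ => ?_
    have := hφ' lam
    have := hφ' μ
    field_simp
    push_cast
    ring

end Bridges

/-! ## §3 King's refinement pairing of alias modes: `(l, m = 0)` at level `R·N` ↔ `l` at level `N` -/

section Pairing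

variable {N R : ℕ}

/-- the bound making `ι` well defined. [folklore] -/
theorem iota_lt [NeZero R] (k : Fin d → Fin N) (s : Fin d → ℝ) (ν : Fin d) :
    (k ν : ℕ) + (R * N - N) * symmShift N k s ν < R * N := by
  have hk := (k ν).isLt
  have hR : 1 ≤ R := Nat.one_le_iff_ne_zero.mpr (NeZero.ne R)
  have hRN : N ≤ R * N := Nat.le_mul_of_pos_left N hR
  rcases King1986.symmShift_le_one N k s ν with h | h <;> rw [h] <;> omega

/-- **King's pairing.**  The alias index at level `R·N` carrying the SAME physical momentum
`q̃ = symmAlias N k p′` as the index `k` at level `N` (King's «m = 0» term of (4.19)):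
`ι(k)_ν = k_ν + (RN − N)·χ_ν`, `χ = King1986.symmShift` the pull-back indicator. [cite: King1986, (4.19) p.672] [folklore] -/
def iota (R : ℕ) [NeZero R] (k : Fin d → Fin N) (s : Fin d → ℝ) : Fin d → Fin (R * N) :=
  fun ν => ⟨(k ν : ℕ) + (R * N - N) * symmShift N k s ν, iota_lt k s ν⟩

/-- `p′ + 2πk = symmAlias N k p′ + 2πN·χ` coordinatewise (`χ = King1986.symmShift`). [folklore] -/
theorem shiftr_symmAlias (k : Fin d → Fin N) (s : Fin d → ℝ) (ν : Fin d) :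
    shiftr N k s ν = symmAlias N k s ν + 2 * Real.pi * ((N * symmShift N k s ν : ℕ) : ℝ) := by
  unfold King1986.symmAlias; push_cast; ring

/-- `p′ + 2π(ι k) = symmAlias N k p′ + 2π(RN)·χ` coordinatewise: the paired index has the SAME physical momentum. [folklore] -/
theorem shiftr_iota [NeZero R] (k : Fin d → Fin N) (s : Fin d → ℝ) (ν : Fin d) :
    shiftr (R * N) (iota R k s) s ν
      = symmAlias N k s ν + 2 * Real.pi * (((R * N) * symmShift N k s ν : ℕ) : ℝ) := by
  have hR : 1 ≤ R := Nat.one_le_iff_ne_zero.mpr (NeZero.ne R)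
  have hRN : N ≤ R * N := Nat.le_mul_of_pos_left N hR
  unfold King1986.symmAlias iota shiftr
  push_cast
  rw [Nat.cast_sub hRN]
  push_cast
  ring

/-- level `N`: the symmetric representative represents the index `k`. [folklore] -/
theorem isRep_symmAlias (hN : 1 ≤ N) (k : Fin d → Fin N) {s : Fin d → ℝ} (hs : ∀ ν, |s ν| ≤ Real.pi) :
    IsRep N k s (symmAlias N k s) :=
  ⟨fun ν => ⟨symmShift N k s ν, shiftr_symmAlias k s ν⟩, fun ν => King1986.symmAlias_abs_le hN k hs ν⟩

/-- level `R·N`: the SAME momentum represents the paired index `ι k`. [cite: King1986, (4.19) p.672] [folklore] -/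
theorem isRep_iota [NeZero R] (hN : 1 ≤ N) (k : Fin d → Fin N) {s : Fin d → ℝ}
    (hs : ∀ ν, |s ν| ≤ Real.pi) : IsRep (R * N) (iota R k s) s (symmAlias N k s) := by
  have hR : 1 ≤ R := Nat.one_le_iff_ne_zero.mpr (NeZero.ne R)
  refine ⟨fun ν => ⟨symmShift N k s ν, shiftr_iota k s ν⟩, fun ν => ?_⟩
  exact zone_RN hR (King1986.symmAlias_abs_le hN k hs ν)

/-- the pull-back indicators agree, hence `symmAlias (RN) (ι k) = symmAlias N k`. [folklore] -/
theorem symmShift_iota [NeZero R] (hN : 1 ≤ N) (k : Fin d → Fin N) {s : Fin d → ℝ}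
    (hs : ∀ ν, |s ν| ≤ Real.pi) (ν : Fin d) : symmShift (R * N) (iota R k s) s ν = symmShift N k s ν := by
  have hR : 1 ≤ R := Nat.one_le_iff_ne_zero.mpr (NeZero.ne R)
  have hπ := Real.pi_pos
  have hN1 : (1 : ℝ) ≤ N := by exact_mod_cast hN
  have hR1 : (1 : ℝ) ≤ R := by exact_mod_cast hR
  have hq := King1986.symmAlias_abs_le hN k hs ν
  obtain ⟨hlo, hhi⟩ := King1986.shiftr_mem k hs ν
  have e := shiftr_iota (R := R) k s ν
  unfold King1986.symmShift at e ⊢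
  by_cases hc : Real.pi * N < shiftr N k s ν
  · rw [if_pos hc] at e ⊢
    rw [if_pos]
    rw [e]; unfold King1986.symmAlias King1986.symmShift; rw [if_pos hc]; push_cast; nlinarith
  · rw [if_neg hc] at e ⊢
    rw [if_neg]
    rw [e]; unfold King1986.symmAlias King1986.symmShift; rw [if_neg hc]; push_cast
    push Not at hc ⊢; nlinarith

/-- `symmAlias (RN) (ι k) p′ = symmAlias N k p′`. [folklore] -/
theorem symmAlias_iota [NeZero R] (hN : 1 ≤ N) (k : Fin d → Fin N) {s : Fin d → ℝ}
    (hs : ∀ ν, |s ν| ≤ Real.pi) : symmAlias (R * N) (iota R k s) s = symmAlias N k s := by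
  funext ν
  have e := shiftr_iota (R := R) k s ν
  unfold King1986.symmAlias at e ⊢
  rw [symmShift_iota hN k hs ν, e]
  push_cast; ring

/-- `ι` is injective (distinct coarse aliases pair with distinct fine aliases). [folklore] -/
theorem iota_injective [NeZero R] (hN : 1 ≤ N) {s : Fin d → ℝ} (hs : ∀ ν, |s ν| ≤ Real.pi) :
    Function.Injective (fun k : Fin d → Fin N => iota R k s) := by
  intro k k' h
  have e := symmAlias_iota (R := R) hN k hs
  have e' := symmAlias_iota (R := R) hN k' hs
  have hkk : symmAlias N k s = symmAlias N k' s := by rw [← e, ← e']; simp only at h; rw [h]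
  -- `symmAlias` determines `k`: `q̃_ν ≡ s_ν + 2πk_ν (mod 2πN)` with `k_ν < N`
  funext ν
  have hν := congrFun hkk ν
  unfold King1986.symmAlias shiftr at hν
  have hπ := Real.pi_pos
  -- `2π(k − k′) = 2πN(χ − χ′)` with `|k − k′| < N` ⇒ `k = k′`
  rcases King1986.symmShift_le_one N k s ν with h0 | h0 <;>
    rcases King1986.symmShift_le_one N k' s ν with h1 | h1 <;>
    rw [h0, h1] at hν <;> push_cast at hν
  · exact Fin.ext (by exact_mod_cast (by nlinarith : ((k ν : ℕ) : ℝ) = (k' ν : ℕ)))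
  · exfalso
    have := (k ν).isLt; have := (k' ν).isLt
    have hk : ((k ν : ℕ) : ℝ) = (k' ν : ℕ) - N := by nlinarith
    have : ((k' ν : ℕ) : ℝ) < N := by exact_mod_cast (k' ν).isLt
    have : (0 : ℝ) ≤ (k ν : ℕ) := by positivity
    linarith
  · exfalso
    have hk : ((k' ν : ℕ) : ℝ) = (k ν : ℕ) - N := by nlinarith
    have : ((k ν : ℕ) : ℝ) < N := by exact_mod_cast (k ν).isLt
    have : (0 : ℝ) ≤ (k' ν : ℕ) := by positivity
    linarith
  · exact Fin.ext (by exact_mod_cast (by nlinarith : ((k ν : ℕ) : ℝ) = (k' ν : ℕ)))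

end Pairing

/-! ## §4 The real-zone alias-decay majorant of (1.63) — King's (4.20)/(4.21) shape -/

section Majorant

/-- one-coordinate decay factor of `ū`, `v̄_μ`: `1` on an unaliased coordinate (`q_ν = p′_ν`), King's
`(π/2)|p′_ν|·|q_ν|⁻¹` on an aliased one ((4.20): «|u(p′+l+m)| < C Π_μ |p′_μ||(p′+l+m)_μ|⁻¹»).
[cite: King1986, (4.20) p.672] [folklore] -/
def vMaj (s q : Fin d → ℝ) (ν : Fin d) : ℝ := if q ν = s ν then 1 else Real.pi / 2 * |s ν| / |q ν|

/-- `vMaj ≥ 0`. [folklore] -/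
theorem vMaj_nonneg (s q : Fin d → ℝ) (ν : Fin d) : 0 ≤ vMaj s q ν := by
  unfold vMaj; split_ifs <;> positivity

/-- `‖f_{1/n}(q_ν)‖ ≤ vMaj`. [cite: King1986, (4.20) p.672] [folklore] -/
theorem norm_uFac_le_vMaj {n : ℕ} (hn : 1 ≤ n) {s q : Fin d → ℝ} {ν : Fin d} (hs : |s ν| ≤ Real.pi)
    (hq : |q ν| ≤ Real.pi * n) (m : ℤ) (hm : q ν = s ν + 2 * Real.pi * m) :
    ‖uFac ((n : ℝ)⁻¹) (q ν)‖ ≤ vMaj s q ν := by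
  unfold vMaj
  split_ifs with h
  · exact norm_uFac_le_one hn hq
  · exact norm_uFac_le_alias hn m hm h hs hq

/-- `‖ū_{1/n}(q)‖ ≤ Π_ν vMaj`. [cite: King1986, (4.20) p.672] [folklore] -/
theorem norm_uWeight_le_vMaj {n : ℕ} (hn : 1 ≤ n) {s q : Fin d → ℝ} (hs : ∀ ν, |s ν| ≤ Real.pi)
    (hq : ∀ ν, |q ν| ≤ Real.pi * n) (hrep : ∀ ν, ∃ m : ℤ, q ν = s ν + 2 * Real.pi * m) :
    ‖uWeight ((n : ℝ)⁻¹) q‖ ≤ ∏ ν, vMaj s q ν := by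
  rw [King1986.norm_uWeight]
  refine Finset.prod_le_prod (fun ν _ => norm_nonneg _) fun ν _ => ?_
  obtain ⟨m, hm⟩ := hrep ν
  exact norm_uFac_le_vMaj hn (hs ν) (hq ν) m hm

/-- an alias of a nonzero zone momentum is nonzero. [folklore] -/
theorem momSq_pos_of_rep {s q : Fin d → ℝ} (hs : ∀ ν, |s ν| ≤ Real.pi) (ν₀ : Fin d) (hν₀ : s ν₀ ≠ 0)
    (hrep : ∀ ν, ∃ m : ℤ, q ν = s ν + 2 * Real.pi * m) : 0 < momSq q := by
  have hq0 : q ν₀ ≠ 0 := by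
    obtain ⟨m, hm⟩ := hrep ν₀
    intro h0
    rw [h0] at hm
    have hπ := Real.pi_pos
    have hsb := abs_le.mp (hs ν₀)
    rcases eq_or_ne m 0 with hm0 | hm0
    · rw [hm0] at hm; simp at hm; exact hν₀ hm.symm
    · have hm1 : (1 : ℝ) ≤ |(m : ℝ)| := by rw [← Int.cast_abs]; exact_mod_cast Int.one_le_abs hm0
      have : |s ν₀| = 2 * Real.pi * |(m : ℝ)| := by
        rw [show s ν₀ = -(2 * Real.pi * m) by linarith, abs_neg, abs_mul, abs_of_pos (by positivity)]
      nlinarith [hs ν₀]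
  unfold King1986.momSq
  have : 0 < q ν₀ ^ 2 := by positivity
  exact lt_of_lt_of_le this (Finset.single_le_sum (fun ν _ => sq_nonneg (q ν)) (Finset.mem_univ ν₀))

/-- the HEAD majorant `Π_ν vMaj · vMaj_μ · (π²/4)|q|⁻² · Δ₀(p′)/γ₀`. [cite: King1986, (4.20)–(4.21) p.672] [folklore] -/
def headMaj (d : ℕ) (s q : Fin d → ℝ) (μ : Fin d) : ℝ :=
  (∏ ν, vMaj s q ν) * vMaj s q μ * (Real.pi ^ 2 / 4 / momSq q) * (Delta1r 0 s / T4GaugeActionRate.gam0 d)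

/-- the majorant of the bracket `φ_μ/(Δ(q)ψ) − |v_μ|²`. [folklore] -/
def sMaj (d : ℕ) (s q : Fin d → ℝ) (μ : Fin d) : ℝ :=
  Real.pi ^ 2 / 4 * Delta1r 0 s / (T4GaugeActionRate.gam0 d * momSq q) + vMaj s q μ

/-- the TAIL majorant `|q_μ| · Π_ν vMaj · (π²/4)|q|⁻² · sMaj · |p′_λ| / γ₀²`. [cite: King1986, (4.20)–(4.21) p.672] [folklore] -/
def tailMaj (d : ℕ) (s q : Fin d → ℝ) (μ lam : Fin d) : ℝ :=
  |q μ| * (∏ ν, vMaj s q ν) * (Real.pi ^ 2 / 4 / momSq q) * sMaj d s q μ * |s lam|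
    * (Delta1r 0 s / T4GaugeActionRate.gam0 d) * (Delta1r 0 s / T4GaugeActionRate.gam0 d) * (1 / Delta1r 0 s ^ 2)

/-- **the alias-decay majorant of the (1.63) multiplier** at real momenta, `d`-only constants.
[cite: King1986, Proposition 3.8 / (4.20)–(4.21) p.672] [folklore] -/
def maj163 (d : ℕ) (s q : Fin d → ℝ) (μ lam : Fin d) : ℝ :=
  (if lam = μ then headMaj d s q μ else 0) + tailMaj d s q μ lam

/-- `headMaj ≥ 0`. [folklore] -/
theorem headMaj_nonneg (s q : Fin d → ℝ) (μ : Fin d) : 0 ≤ headMaj d s q μ := by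
  unfold headMaj
  have := T4GaugeActionRate.gam0_pos d
  have := King1986.momSq_nonneg q
  have := Delta1r_nonneg 0 le_rfl s
  have := vMaj_nonneg s q μ
  have := Finset.prod_nonneg fun ν (_ : ν ∈ Finset.univ) => vMaj_nonneg s q ν
  positivity

/-- `sMaj ≥ 0`. [folklore] -/
theorem sMaj_nonneg (s q : Fin d → ℝ) (μ : Fin d) : 0 ≤ sMaj d s q μ := by
  unfold sMaj
  have := T4GaugeActionRate.gam0_pos d
  have := King1986.momSq_nonneg q
  have := Delta1r_nonneg 0 le_rfl s
  have := vMaj_nonneg s q μ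
  positivity

/-- `tailMaj ≥ 0`. [folklore] -/
theorem tailMaj_nonneg (s q : Fin d → ℝ) (μ lam : Fin d) : 0 ≤ tailMaj d s q μ lam := by
  unfold tailMaj
  have := T4GaugeActionRate.gam0_pos d
  have := King1986.momSq_nonneg q
  have := Delta1r_nonneg 0 le_rfl s
  have := sMaj_nonneg (d := d) s q μ
  have := Finset.prod_nonneg fun ν (_ : ν ∈ Finset.univ) => vMaj_nonneg s q ν
  positivity

/-- `maj163 ≥ 0`. [folklore] -/
theorem maj163_nonneg (s q : Fin d → ℝ) (μ lam : Fin d) : 0 ≤ maj163 d s q μ lam := by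
  unfold maj163
  have := headMaj_nonneg (d := d) s q μ
  have := tailMaj_nonneg (d := d) s q μ lam
  split_ifs <;> positivity

/-! ### factor bounds (level-generic: `n ≥ 1`, `|q_ν| ≤ πn`, `p′` in the punctured zone) -/

section FactorBounds

variable {n : ℕ} [NeZero n] (hn : 1 ≤ n) {s q : Fin d → ℝ} (hs : ∀ ν, |s ν| ≤ Real.pi) (ν₀ : Fin d)
  (hν₀ : s ν₀ ≠ 0)
include hn hs hν₀

omit [NeZero n] hs hν₀ in
/-- `‖Δ^η(q)⁻¹‖ ≤ (π²/4)|q|⁻²` on the fine zone (the `|p′+l+m|⁻²` of (4.21)). [cite: King1986, (4.21) p.672 (shape only)] [folklore] -/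
theorem norm_inv_DeltaXir_le (hq : ∀ ν, |q ν| ≤ Real.pi * n) (hq0 : 0 < momSq q) :
    ‖(((DeltaXir n 0 q : ℝ) : ℂ))⁻¹‖ ≤ Real.pi ^ 2 / 4 / momSq q := by
  have h := DeltaXir_ge_momSq hn hq
  have hc : 0 < 4 / Real.pi ^ 2 * momSq q := by positivity
  have hD : 0 < DeltaXir n 0 q := hc.trans_le h
  rw [norm_inv, Complex.norm_real, Real.norm_eq_abs, abs_of_pos hD]
  calc (DeltaXir n 0 q)⁻¹ ≤ (4 / Real.pi ^ 2 * momSq q)⁻¹ := inv_anti₀ hc h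
    _ = Real.pi ^ 2 / 4 / momSq q := by field_simp

/-- `‖φ_ν(p′)⁻¹‖ ≤ Δ₀(p′)/γ₀`. [folklore] -/
theorem norm_inv_phi162_le (ν : Fin d) :
    ‖(((phi162 n ν s : ℝ) : ℂ))⁻¹‖ ≤ Delta1r 0 s / T4GaugeActionRate.gam0 d := by
  have hφ := phi162_pos' hn ν s hs ν₀ hν₀
  have hΔ := Delta1r_pos s hs ν₀ hν₀
  have hg := T4GaugeActionRate.gam0_pos d
  have hlow := B5Bounds167Lattice.Delta0_phi162_lower n hn ν s hs ν₀ hν₀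
  rw [norm_inv, Complex.norm_real, Real.norm_eq_abs, abs_of_pos hφ, inv_le_comm₀ hφ (by positivity)]
  -- `(Δ₀/γ₀)⁻¹ = γ₀/Δ₀ ≤ φ`
  rw [inv_div, div_le_iff₀ hΔ]
  unfold T4GaugeActionRate.gam0; linarith

/-- `‖φ_ν(p′)‖ ≤ 1/Δ₀(p′)` (from `B5Bounds167Lattice.Delta0_phi162_le_one`). [folklore] -/
theorem norm_phi162_le (ν : Fin d) : ‖((phi162 n ν s : ℝ) : ℂ)‖ ≤ 1 / Delta1r 0 s := by
  have hφ := phi162_pos' hn ν s hs ν₀ hν₀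
  have hΔ := Delta1r_pos s hs ν₀ hν₀
  have h1 := B5Bounds167Lattice.Delta0_phi162_le_one n hn ν s hs
  rw [Complex.norm_real, Real.norm_eq_abs, abs_of_pos hφ, le_div_iff₀ hΔ]
  linarith

/-- `‖ψ(p′)⁻¹‖ ≤ Δ₀(p′)²/γ₀`. [folklore] -/
theorem norm_inv_psiSum_le :
    ‖(((psiSum n s : ℝ) : ℂ))⁻¹‖ ≤ Delta1r 0 s ^ 2 / T4GaugeActionRate.gam0 d := by
  have hψ := psiSum_pos hn s hs ν₀ hν₀
  have hΔ := Delta1r_pos s hs ν₀ hν₀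
  have hg := T4GaugeActionRate.gam0_pos d
  have hlow := psiSum_lower hn s hs ν₀ hν₀
  rw [norm_inv, Complex.norm_real, Real.norm_eq_abs, abs_of_pos hψ, inv_le_comm₀ hψ (by positivity), inv_div]
  exact hlow

/-- `‖E(p′)⁻¹‖ ≤ 1/Δ₀(p′)²`. [folklore] -/
theorem norm_inv_E1_le : ‖(((E1 n s : ℝ) : ℂ))⁻¹‖ ≤ 1 / Delta1r 0 s ^ 2 := by
  have hE := E1_pos hn s hs ν₀ hν₀
  have hΔ := Delta1r_pos s hs ν₀ hν₀
  have hlow := E1_lower hn s hs ν₀ hν₀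
  rw [norm_inv, Complex.norm_real, Real.norm_eq_abs, abs_of_pos hE, one_div]
  exact inv_anti₀ (by positivity) hlow

omit [NeZero n] hn hs hν₀ in
/-- `‖∂_μ(q)‖ ≤ |q_μ|` (King p.672: «(η′)⁻¹|exp[iη′(p′+l+m)_μ] − 1| ≤ C|(p′+l+m)_μ|», here `C = 1`). [cite: King1986, p.672 (text after (4.21))] [folklore] -/
theorem norm_conj_fdq_le (hn : 1 ≤ n) (x : ℝ) : ‖conj (fdq ((n : ℝ)⁻¹) x)‖ ≤ |x| := by
  rw [Complex.norm_conj]; exact norm_fdq_le' hn x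

omit [NeZero n] hs hν₀ in
/-- `‖ |v̄_ν(q)|² ‖ ≤ vMaj_ν` (as `|v̄_ν| ≤ 1`). [folklore] -/
theorem norm_normSq_uFac_le (hq : |q ν₀| ≤ Real.pi * n) (hv : ‖uFac ((n : ℝ)⁻¹) (q ν₀)‖ ≤ vMaj s q ν₀) :
    ‖(((‖uFac ((n : ℝ)⁻¹) (q ν₀)‖ ^ 2 : ℝ)) : ℂ)‖ ≤ vMaj s q ν₀ := by
  rw [Complex.norm_real, Real.norm_eq_abs, abs_of_nonneg (by positivity), sq]
  have h1 := norm_uFac_le_one hn hq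
  have h0 := norm_nonneg (uFac ((n : ℝ)⁻¹) (q ν₀))
  nlinarith

/-- the bracket `φ_μ/(Δ(q)ψ) − |v_μ|²` is bounded by `sMaj`. [folklore] -/
theorem norm_bracket_le (μ : Fin d) (hq : ∀ ν, |q ν| ≤ Real.pi * n) (hq0 : 0 < momSq q)
    (hrep : ∀ ν, ∃ m : ℤ, q ν = s ν + 2 * Real.pi * m) :
    ‖((phi162 n μ s : ℝ) : ℂ) / ((((DeltaXir n 0 q : ℝ) : ℂ)) * ((psiSum n s : ℝ) : ℂ))
        - (((‖uFac ((n : ℝ)⁻¹) (q μ)‖ ^ 2 : ℝ)) : ℂ)‖ ≤ sMaj d s q μ := by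
  have hΔ := Delta1r_pos s hs ν₀ hν₀
  have hg := T4GaugeActionRate.gam0_pos d
  obtain ⟨m, hm⟩ := hrep μ
  have hv := norm_uFac_le_vMaj hn (hs μ) (hq μ) m hm
  have hW := norm_normSq_uFac_le (s := s) hn μ (hq μ) hv
  have h1 := norm_phi162_le hn hs ν₀ hν₀ μ
  have h2 := norm_inv_DeltaXir_le hn hq hq0
  have h3 := norm_inv_psiSum_le hn hs ν₀ hν₀
  refine (norm_sub_le _ _).trans ?_
  unfold sMaj
  refine add_le_add ?_ hW
  rw [div_eq_mul_inv, mul_inv]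
  calc ‖((phi162 n μ s : ℝ) : ℂ) * ((((DeltaXir n 0 q : ℝ) : ℂ))⁻¹ * (((psiSum n s : ℝ) : ℂ))⁻¹)‖
      ≤ 1 / Delta1r 0 s * (Real.pi ^ 2 / 4 / momSq q * (Delta1r 0 s ^ 2 / T4GaugeActionRate.gam0 d)) :=
        norm_mul_le_of_le h1 (norm_mul_le_of_le h2 h3)
    _ = Real.pi ^ 2 / 4 * Delta1r 0 s / (T4GaugeActionRate.gam0 d * momSq q) := by
        field_simp

end FactorBounds

/-- the multiplier as a sum of two PRODUCTS of its factors. [folklore] -/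
theorem hPhys_eq_prod (n : ℕ) (μ lam : Fin d) (q s : Fin d → ℝ) :
    hPhys n μ lam q s
      = (if lam = μ then
          uWeight ((n : ℝ)⁻¹) q * uFac ((n : ℝ)⁻¹) (q μ) * (((DeltaXir n 0 q : ℝ) : ℂ))⁻¹
            * (((phi162 n μ s : ℝ) : ℂ))⁻¹ else 0)
        + conj (fdq ((n : ℝ)⁻¹) (q μ)) * uWeight ((n : ℝ)⁻¹) q * (((DeltaXir n 0 q : ℝ) : ℂ))⁻¹
          * (((phi162 n μ s : ℝ) : ℂ) / ((((DeltaXir n 0 q : ℝ) : ℂ)) * ((psiSum n s : ℝ) : ℂ))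
              - (((‖uFac ((n : ℝ)⁻¹) (q μ)‖ ^ 2 : ℝ)) : ℂ))
          * conj (d1Sym s lam) * (((phi162 n μ s : ℝ) : ℂ))⁻¹ * (((phi162 n lam s : ℝ) : ℂ))⁻¹
          * (((E1 n s : ℝ) : ℂ))⁻¹ := by
  unfold hPhys
  split_ifs <;> ring

/-- **THEOREM A (alias-decay majorant, (4.20)/(4.21) shape).**  For `n ≥ 1`, `p′ = s` in the punctured zone, and
any alias momentum `q` of `p′` in the level-`n` fine zone (`q_ν − p′_ν ∈ 2πℤ`, `|q_ν| ≤ πn`):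
`‖h^{(n)}_{μλ}(q; p′)‖ ≤ maj163 d p′ q μ λ`, a `d`-only majorant carrying King's `Π_ν |p′_ν|/|q_ν|`
alias decay of `ū` and the `|q|⁻²` of `Δ^{(n)}(q)⁻¹`, UNIFORMLY in `n`.
[cite: King1986, Proposition 3.8 with (4.20)–(4.21) p.672] [folklore] -/
theorem norm_hPhys_le {n : ℕ} [NeZero n] (hn : 1 ≤ n) (μ lam : Fin d) {s q : Fin d → ℝ}
    (hs : ∀ ν, |s ν| ≤ Real.pi) (ν₀ : Fin d) (hν₀ : s ν₀ ≠ 0) (hq : ∀ ν, |q ν| ≤ Real.pi * n)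
    (hrep : ∀ ν, ∃ m : ℤ, q ν = s ν + 2 * Real.pi * m) :
    ‖hPhys n μ lam q s‖ ≤ maj163 d s q μ lam := by
  have hq0 : 0 < momSq q := momSq_pos_of_rep hs ν₀ hν₀ hrep
  have hΔ := Delta1r_pos s hs ν₀ hν₀
  obtain ⟨m, hm⟩ := hrep μ
  have bU := norm_uWeight_le_vMaj hn hs hq hrep
  have bV := norm_uFac_le_vMaj hn (hs μ) (hq μ) m hm
  have bD := norm_inv_DeltaXir_le hn hq hq0
  have bPm := norm_inv_phi162_le hn hs ν₀ hν₀ μ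
  have bPl := norm_inv_phi162_le hn hs ν₀ hν₀ lam
  have bF := norm_conj_fdq_le hn (q μ)
  have bS := norm_bracket_le hn hs ν₀ hν₀ μ hq hq0 hrep
  have bC := norm_conj_d1Sym_le s lam
  have bE := norm_inv_E1_le hn hs ν₀ hν₀
  rw [hPhys_eq_prod]
  refine (norm_add_le _ _).trans ?_
  unfold maj163
  gcongr ?_ + ?_
  · split_ifs with h
    · unfold headMaj
      exact norm_mul_le_of_le (norm_mul_le_of_le (norm_mul_le_of_le bU bV) bD) bPm
    · simp
  · unfold tailMaj
    exact norm_mul_le_of_le (norm_mul_le_of_le (norm_mul_le_of_le (norm_mul_le_of_le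
      (norm_mul_le_of_le (norm_mul_le_of_le (norm_mul_le_of_le bF bU) bD) bS) bC) bPm) bPl) bE

end Majorant

/-! ## §5 «We successively replace each factor by the corresponding one … and bound the error» — the η-RATE -/

section Rate

/-- two factors: uniform majorants `‖a‖ ≤ A`, `‖b′‖ ≤ B` and relative rates `ε_a`, `ε_b` give
`‖ab − a′b′‖ ≤ (ε_a + ε_b)·AB` (King p.673: «By repeated use of the identity xy − zw = …»). [folklore] -/
theorem rate_mul {a b a' b' : ℂ} {A B εa εb : ℝ} (ha : ‖a‖ ≤ A) (hb' : ‖b'‖ ≤ B)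
    (hab : ‖a - a'‖ ≤ εa * A) (hbb : ‖b - b'‖ ≤ εb * B) (hεa : 0 ≤ εa) :
    ‖a * b - a' * b'‖ ≤ (εa + εb) * (A * B) := by
  have hA : 0 ≤ A := (norm_nonneg _).trans ha
  have hB : 0 ≤ B := (norm_nonneg _).trans hb'
  calc ‖a * b - a' * b'‖ = ‖a * (b - b') + (a - a') * b'‖ := by ring_nf
    _ ≤ ‖a‖ * ‖b - b'‖ + ‖a - a'‖ * ‖b'‖ := by
        refine (norm_add_le _ _).trans ?_; rw [norm_mul, norm_mul]
    _ ≤ A * (εb * B) + (εa * A) * B := by gcongr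
    _ = (εa + εb) * (A * B) := by ring

/-- the constants of the rate. [folklore] -/
def A163 (d : ℕ) : ℝ := 1 + Real.pi + Real.pi ^ 3 / 24 + (Real.pi / 2) ^ (d + 1)

/-- the constants of the rate. [folklore] -/
def B163 (d : ℕ) : ℝ := 4 * d * (4 * Cphi + Cpsi) / T4GaugeActionRate.gam0 d ^ 2

variable {N R : ℕ} [NeZero N] [NeZero R] (hN : 1 ≤ N) (hR : 1 ≤ R) {s : Fin d → ℝ}
  (hs : ∀ ν, |s ν| ≤ Real.pi) (ν₀ : Fin d) (hν₀ : s ν₀ ≠ 0)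

omit [NeZero N] [NeZero R] in
/-- `R·N ≥ 1`. [folklore] -/
theorem one_le_RN (hN : 1 ≤ N) (hR : 1 ≤ R) : 1 ≤ R * N :=
  Nat.one_le_iff_ne_zero.mpr (Nat.mul_ne_zero (by omega) (by omega))

/-- `R·N ≠ 0`. [folklore] -/
instance instNeZeroMul : NeZero (R * N) := ⟨Nat.mul_ne_zero (NeZero.ne R) (NeZero.ne N)⟩

/-- norm of a difference of inverted real casts. [folklore] -/
theorem norm_inv_ofReal_sub (x y : ℝ) :
    ‖(((x : ℝ) : ℂ))⁻¹ - (((y : ℝ) : ℂ))⁻¹‖ = |x⁻¹ - y⁻¹| := by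
  rw [← Complex.ofReal_inv, ← Complex.ofReal_inv, ← Complex.ofReal_sub, Complex.norm_real, Real.norm_eq_abs]

omit [NeZero N] [NeZero R] in
/-- `|x⁻¹ − y⁻¹| ≤ r·L²` from `|x − y| ≤ r` and `x, y ≥ L⁻¹ > 0`. [folklore] -/
theorem abs_inv_sub_inv_le {x y r L : ℝ} (hx : 0 < x) (hy : 0 < y) (hL : 0 < L) (hxL : 1 ≤ L * x)
    (hyL : 1 ≤ L * y) (hr : |x - y| ≤ r) : |x⁻¹ - y⁻¹| ≤ r * L ^ 2 := by
  rw [inv_sub_inv hx.ne' hy.ne', abs_div, abs_of_pos (mul_pos hx hy), div_le_iff₀ (mul_pos hx hy),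
    abs_sub_comm]
  have hr0 : 0 ≤ r := (abs_nonneg _).trans hr
  calc |x - y| ≤ r := hr
    _ = r * 1 * 1 := by ring
    _ ≤ r * (L * x) * (L * y) := by gcongr
    _ = r * L ^ 2 * (x * y) := by ring

include hN hR hs hν₀

/-- (R6) `‖φ_N⁻¹ − φ_{RN}⁻¹‖ ≤ (4dC_φ/γ₀)·N⁻²·(Δ₀/γ₀)`. [folklore] -/
theorem inv_phi162_rate (ν : Fin d) :
    ‖(((phi162 N ν s : ℝ) : ℂ))⁻¹ - (((phi162 (R * N) ν s : ℝ) : ℂ))⁻¹‖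
      ≤ 4 * d * Cphi / T4GaugeActionRate.gam0 d * ((N : ℝ) ^ 2)⁻¹
          * (Delta1r 0 s / T4GaugeActionRate.gam0 d) := by
  have hRN := one_le_RN hN hR
  have hΔ := Delta1r_pos s hs ν₀ hν₀
  have hΔle : Delta1r 0 s ≤ 4 * d := Delta1r_le s
  have hg := T4GaugeActionRate.gam0_pos d
  have hC := B5ActionRate166.Cphi_pos
  have hx := phi162_pos' hN ν s hs ν₀ hν₀
  have hy := phi162_pos' hRN ν s hs ν₀ hν₀
  have hlx := B5Bounds167Lattice.Delta0_phi162_lower N hN ν s hs ν₀ hν₀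
  have hly := B5Bounds167Lattice.Delta0_phi162_lower (R * N) hRN ν s hs ν₀ hν₀
  have hr := B5ActionRate166.phi162_rate hN hR ν s hs ν₀ hν₀
  rw [abs_sub_comm] at hr
  rw [norm_inv_ofReal_sub]
  have key := abs_inv_sub_inv_le (L := Delta1r 0 s / T4GaugeActionRate.gam0 d) hx hy (by positivity)
    (by rw [div_mul_eq_mul_div, le_div_iff₀ hg, one_mul]; exact hlx)
    (by rw [div_mul_eq_mul_div, le_div_iff₀ hg, one_mul]; exact hly) hr
  refine key.trans ?_
  have hN2 : 0 ≤ ((N : ℝ) ^ 2)⁻¹ := by positivity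
  have h4 : Delta1r 0 s / T4GaugeActionRate.gam0 d ≤ 4 * d / T4GaugeActionRate.gam0 d := by gcongr
  calc Cphi * ((N : ℝ) ^ 2)⁻¹ * (Delta1r 0 s / T4GaugeActionRate.gam0 d) ^ 2
      = Cphi * (Delta1r 0 s / T4GaugeActionRate.gam0 d) * ((N : ℝ) ^ 2)⁻¹
          * (Delta1r 0 s / T4GaugeActionRate.gam0 d) := by ring
    _ ≤ Cphi * (4 * d / T4GaugeActionRate.gam0 d) * ((N : ℝ) ^ 2)⁻¹
          * (Delta1r 0 s / T4GaugeActionRate.gam0 d) := by gcongr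
    _ = 4 * d * Cphi / T4GaugeActionRate.gam0 d * ((N : ℝ) ^ 2)⁻¹
          * (Delta1r 0 s / T4GaugeActionRate.gam0 d) := by ring

/-- (R5) `‖φ_N − φ_{RN}‖ ≤ 4dC_φ·N⁻²·(1/Δ₀)`. [folklore] -/
theorem phi162_rate' (ν : Fin d) :
    ‖((phi162 N ν s : ℝ) : ℂ) - ((phi162 (R * N) ν s : ℝ) : ℂ)‖
      ≤ 4 * d * Cphi * ((N : ℝ) ^ 2)⁻¹ * (1 / Delta1r 0 s) := by
  have hΔ := Delta1r_pos s hs ν₀ hν₀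
  have hΔle : Delta1r 0 s ≤ 4 * d := Delta1r_le s
  have hC := B5ActionRate166.Cphi_pos
  have hr := B5ActionRate166.phi162_rate hN hR ν s hs ν₀ hν₀
  rw [← Complex.ofReal_sub, Complex.norm_real, Real.norm_eq_abs, abs_sub_comm]
  refine hr.trans ?_
  rw [mul_one_div, le_div_iff₀ hΔ]
  have hN2 : 0 ≤ ((N : ℝ) ^ 2)⁻¹ := by positivity
  calc Cphi * ((N : ℝ) ^ 2)⁻¹ * Delta1r 0 s ≤ Cphi * ((N : ℝ) ^ 2)⁻¹ * (4 * d) := by gcongr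
    _ = 4 * d * Cphi * ((N : ℝ) ^ 2)⁻¹ := by ring

/-- (R7) `‖ψ_N⁻¹ − ψ_{RN}⁻¹‖ ≤ (4dC_ψ/γ₀)·N⁻²·(Δ₀²/γ₀)`. [folklore] -/
theorem inv_psiSum_rate :
    ‖(((psiSum N s : ℝ) : ℂ))⁻¹ - (((psiSum (R * N) s : ℝ) : ℂ))⁻¹‖
      ≤ 4 * d * Cpsi / T4GaugeActionRate.gam0 d * ((N : ℝ) ^ 2)⁻¹
          * (Delta1r 0 s ^ 2 / T4GaugeActionRate.gam0 d) := by
  have hRN := one_le_RN hN hR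
  have hΔ := Delta1r_pos s hs ν₀ hν₀
  have hΔle : Delta1r 0 s ≤ 4 * d := Delta1r_le s
  have hg := T4GaugeActionRate.gam0_pos d
  have hC := B5ActionRate166.Cpsi_pos
  have hx := psiSum_pos hN s hs ν₀ hν₀
  have hy := psiSum_pos hRN s hs ν₀ hν₀
  have hlx := psiSum_lower hN s hs ν₀ hν₀
  have hly := psiSum_lower hRN s hs ν₀ hν₀
  have hr0 := B5ActionRate166.Psi_rate hN hR s hs ν₀ hν₀
  have hr : |psiSum N s - psiSum (R * N) s| ≤ Cpsi * ((N : ℝ) ^ 2)⁻¹ / Delta1r 0 s := by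
    rw [abs_sub_comm, le_div_iff₀ hΔ]
    have : |psiSum (R * N) s - psiSum N s| * Delta1r 0 s
        = |Delta1r 0 s ^ 2 * psiSum (R * N) s - Delta1r 0 s ^ 2 * psiSum N s| / Delta1r 0 s := by
      rw [← mul_sub, abs_mul, abs_of_pos (pow_pos hΔ 2)]; field_simp
    rw [this, div_le_iff₀ hΔ]
    calc |Delta1r 0 s ^ 2 * psiSum (R * N) s - Delta1r 0 s ^ 2 * psiSum N s|
        ≤ Cpsi * Delta1r 0 s * ((N : ℝ) ^ 2)⁻¹ := hr0
      _ = Cpsi * ((N : ℝ) ^ 2)⁻¹ * Delta1r 0 s := by ring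
  rw [norm_inv_ofReal_sub]
  have key := abs_inv_sub_inv_le (L := Delta1r 0 s ^ 2 / T4GaugeActionRate.gam0 d) hx hy (by positivity)
    (by rw [div_mul_eq_mul_div, le_div_iff₀ hg, one_mul]
        have := (div_le_iff₀ (pow_pos hΔ 2)).mp hlx; linarith)
    (by rw [div_mul_eq_mul_div, le_div_iff₀ hg, one_mul]
        have := (div_le_iff₀ (pow_pos hΔ 2)).mp hly; linarith) hr
  refine key.trans ?_
  have hN2 : 0 ≤ ((N : ℝ) ^ 2)⁻¹ := by positivity
  have h4 : Delta1r 0 s / T4GaugeActionRate.gam0 d ≤ 4 * d / T4GaugeActionRate.gam0 d := by gcongr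
  calc Cpsi * ((N : ℝ) ^ 2)⁻¹ / Delta1r 0 s * (Delta1r 0 s ^ 2 / T4GaugeActionRate.gam0 d) ^ 2
      = Cpsi * (Delta1r 0 s / T4GaugeActionRate.gam0 d) * ((N : ℝ) ^ 2)⁻¹
          * (Delta1r 0 s ^ 2 / T4GaugeActionRate.gam0 d) := by field_simp
    _ ≤ Cpsi * (4 * d / T4GaugeActionRate.gam0 d) * ((N : ℝ) ^ 2)⁻¹
          * (Delta1r 0 s ^ 2 / T4GaugeActionRate.gam0 d) := by gcongr
    _ = 4 * d * Cpsi / T4GaugeActionRate.gam0 d * ((N : ℝ) ^ 2)⁻¹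
          * (Delta1r 0 s ^ 2 / T4GaugeActionRate.gam0 d) := by ring

/-- (R8) `‖E_N⁻¹ − E_{RN}⁻¹‖ ≤ (4dC_φ/γ₀²)·N⁻²·(1/Δ₀²)`. [folklore] -/
theorem inv_E1_rate :
    ‖(((E1 N s : ℝ) : ℂ))⁻¹ - (((E1 (R * N) s : ℝ) : ℂ))⁻¹‖
      ≤ 4 * d * Cphi / T4GaugeActionRate.gam0 d ^ 2 * ((N : ℝ) ^ 2)⁻¹ * (1 / Delta1r 0 s ^ 2) := by
  have hRN := one_le_RN hN hR
  have hΔ := Delta1r_pos s hs ν₀ hν₀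
  have hΔle : Delta1r 0 s ≤ 4 * d := Delta1r_le s
  have hg := T4GaugeActionRate.gam0_pos d
  have hC := B5ActionRate166.Cphi_pos
  have hx := E1_pos hN s hs ν₀ hν₀
  have hy := E1_pos hRN s hs ν₀ hν₀
  have hlx := E1_lower hN s hs ν₀ hν₀
  have hly := E1_lower hRN s hs ν₀ hν₀
  have hN2 : 0 ≤ ((N : ℝ) ^ 2)⁻¹ := by positivity
  -- `|E_N − E_RN| ≤ Δ₀ · Cφ N⁻² (Δ₀/γ₀)²`
  have hterm : ∀ κ, |S1r (s κ) / phi162 N κ s - S1r (s κ) / phi162 (R * N) κ s|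
      ≤ S1r (s κ) * (Cphi * ((N : ℝ) ^ 2)⁻¹ * (Delta1r 0 s / T4GaugeActionRate.gam0 d) ^ 2) := by
    intro κ
    have hxκ := phi162_pos' hN κ s hs ν₀ hν₀
    have hyκ := phi162_pos' hRN κ s hs ν₀ hν₀
    have hlxκ := B5Bounds167Lattice.Delta0_phi162_lower N hN κ s hs ν₀ hν₀
    have hlyκ := B5Bounds167Lattice.Delta0_phi162_lower (R * N) hRN κ s hs ν₀ hν₀
    have hrκ := B5ActionRate166.phi162_rate hN hR κ s hs ν₀ hν₀
    rw [abs_sub_comm] at hrκ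
    have k := abs_inv_sub_inv_le (L := Delta1r 0 s / T4GaugeActionRate.gam0 d) hxκ hyκ (by positivity)
      (by rw [div_mul_eq_mul_div, le_div_iff₀ hg, one_mul]; exact hlxκ)
      (by rw [div_mul_eq_mul_div, le_div_iff₀ hg, one_mul]; exact hlyκ) hrκ
    rw [div_eq_mul_inv, div_eq_mul_inv, ← mul_sub, abs_mul, abs_of_nonneg (S1r_nonneg _)]
    exact mul_le_mul_of_nonneg_left k (S1r_nonneg _)
  have hdiff : |E1 N s - E1 (R * N) s|
      ≤ Delta1r 0 s * (Cphi * ((N : ℝ) ^ 2)⁻¹ * (Delta1r 0 s / T4GaugeActionRate.gam0 d) ^ 2) := by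
    unfold E1
    rw [← Finset.sum_sub_distrib]
    refine (Finset.abs_sum_le_sum_abs _ _).trans ?_
    calc ∑ κ, |S1r (s κ) / phi162 N κ s - S1r (s κ) / phi162 (R * N) κ s|
        ≤ ∑ κ, S1r (s κ) * (Cphi * ((N : ℝ) ^ 2)⁻¹ * (Delta1r 0 s / T4GaugeActionRate.gam0 d) ^ 2) :=
          Finset.sum_le_sum fun κ _ => hterm κ
      _ = Delta1r 0 s * (Cphi * ((N : ℝ) ^ 2)⁻¹ * (Delta1r 0 s / T4GaugeActionRate.gam0 d) ^ 2) := by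
          rw [← Finset.sum_mul]; unfold Delta1r; ring
  rw [norm_inv_ofReal_sub]
  have key := abs_inv_sub_inv_le (L := 1 / Delta1r 0 s ^ 2) hx hy (by positivity)
    (by rw [one_div, inv_mul_eq_div, le_div_iff₀ (pow_pos hΔ 2), one_mul]; exact hlx)
    (by rw [one_div, inv_mul_eq_div, le_div_iff₀ (pow_pos hΔ 2), one_mul]; exact hly) hdiff
  refine key.trans ?_
  have h4 : Delta1r 0 s / T4GaugeActionRate.gam0 d ^ 2 ≤ 4 * d / T4GaugeActionRate.gam0 d ^ 2 := by
    gcongr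
  calc Delta1r 0 s * (Cphi * ((N : ℝ) ^ 2)⁻¹ * (Delta1r 0 s / T4GaugeActionRate.gam0 d) ^ 2)
        * (1 / Delta1r 0 s ^ 2) ^ 2
      = Cphi * (Delta1r 0 s / T4GaugeActionRate.gam0 d ^ 2) * ((N : ℝ) ^ 2)⁻¹
          * (1 / Delta1r 0 s ^ 2) := by field_simp
    _ ≤ Cphi * (4 * d / T4GaugeActionRate.gam0 d ^ 2) * ((N : ℝ) ^ 2)⁻¹ * (1 / Delta1r 0 s ^ 2) := by
        gcongr
    _ = 4 * d * Cphi / T4GaugeActionRate.gam0 d ^ 2 * ((N : ℝ) ^ 2)⁻¹ * (1 / Delta1r 0 s ^ 2) := by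
        ring

/-- the relative rate of the bracket `S = φ_μ/(Δ(q)ψ) − |v_μ|²`. [folklore] -/
theorem bracket_rate (μ : Fin d) {q : Fin d → ℝ} (hq : ∀ ν, |q ν| ≤ Real.pi * N)
    (hrep : ∀ ν, ∃ m : ℤ, q ν = s ν + 2 * Real.pi * m) :
    ‖(((phi162 N μ s : ℝ) : ℂ) / ((((DeltaXir N 0 q : ℝ) : ℂ)) * ((psiSum N s : ℝ) : ℂ))
        - (((‖uFac ((N : ℝ)⁻¹) (q μ)‖ ^ 2 : ℝ)) : ℂ))
      - (((phi162 (R * N) μ s : ℝ) : ℂ) / ((((DeltaXir (R * N) 0 q : ℝ) : ℂ)) * ((psiSum (R * N) s : ℝ) : ℂ))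
        - (((‖uFac (((R * N : ℕ) : ℝ)⁻¹) (q μ)‖ ^ 2 : ℝ)) : ℂ))‖
      ≤ ((Real.pi ^ 3 / 48 + Real.pi) * ((∑ ν, |q ν|) / N)
          + 4 * d * (Cphi + Cpsi / T4GaugeActionRate.gam0 d) * ((N : ℝ) ^ 2)⁻¹) * sMaj d s q μ := by
  have hRN := one_le_RN hN hR
  have hq' : ∀ ν, |q ν| ≤ Real.pi * (R * N : ℕ) := fun ν => zone_RN hR (hq ν)
  have hq0 := momSq_pos_of_rep hs ν₀ hν₀ hrep
  have hΔ := Delta1r_pos s hs ν₀ hν₀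
  have hg := T4GaugeActionRate.gam0_pos d
  have hC := B5ActionRate166.Cphi_pos
  have hC' := B5ActionRate166.Cpsi_pos
  have hN' : (0 : ℝ) < N := by exact_mod_cast hN
  have hεμ : |q μ| / N ≤ (∑ ν, |q ν|) / N :=
    div_le_div_of_nonneg_right (Finset.single_le_sum (fun ν _ => abs_nonneg (q ν)) (Finset.mem_univ μ))
      hN'.le
  obtain ⟨m, hm⟩ := hrep μ
  have bV := norm_uFac_le_vMaj hN (hs μ) (hq μ) m hm
  -- factor bounds
  have bPhi := norm_phi162_le hN hs ν₀ hν₀ μ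
  have bD := norm_inv_DeltaXir_le hN hq hq0
  have bD' := norm_inv_DeltaXir_le hRN hq' hq0
  have bPsi' := norm_inv_psiSum_le hRN hs ν₀ hν₀
  -- factor rates
  have rPhi := phi162_rate' hN hR hs ν₀ hν₀ μ
  have rD : ‖(((DeltaXir N 0 q : ℝ) : ℂ))⁻¹ - (((DeltaXir (R * N) 0 q : ℝ) : ℂ))⁻¹‖
      ≤ Real.pi ^ 3 / 48 * ((∑ ν, |q ν|) / N) * (Real.pi ^ 2 / 4 / momSq q) := by
    rw [norm_inv_ofReal_sub]; exact inv_DeltaXir_sub_le hN hR hq hq0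
  have rPsi := inv_psiSum_rate hN hR hs ν₀ hν₀
  have rW : ‖(((‖uFac ((N : ℝ)⁻¹) (q μ)‖ ^ 2 : ℝ)) : ℂ) - (((‖uFac (((R * N : ℕ) : ℝ)⁻¹) (q μ)‖ ^ 2 : ℝ)) : ℂ)‖
      ≤ Real.pi * ((∑ ν, |q ν|) / N) * vMaj s q μ := by
    rw [← Complex.ofReal_sub, Complex.norm_real, Real.norm_eq_abs]
    exact (normSq_uFac_rate hN hR (hq μ)).trans (by gcongr)
  -- the product `φ · Δ⁻¹ · ψ⁻¹`
  have p1 := rate_mul bPhi bD' rPhi rD (by positivity)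
  have p2 := rate_mul (norm_mul_le_of_le bPhi bD) bPsi' p1 rPsi (by positivity)
  rw [div_eq_mul_inv, mul_inv, ← mul_assoc, div_eq_mul_inv, mul_inv, ← mul_assoc,
    show ∀ a b c e : ℂ, a - b - (c - e) = (a - c) - (b - e) from fun a b c e => by ring]
  refine (norm_sub_le _ _).trans ((add_le_add p2 rW).trans ?_)
  have e1 : 1 / Delta1r 0 s * (Real.pi ^ 2 / 4 / momSq q) * (Delta1r 0 s ^ 2 / T4GaugeActionRate.gam0 d)
      = Real.pi ^ 2 / 4 * Delta1r 0 s / (T4GaugeActionRate.gam0 d * momSq q) := by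
    field_simp
  rw [e1]
  unfold sMaj
  have hs1 : 0 ≤ Real.pi ^ 2 / 4 * Delta1r 0 s / (T4GaugeActionRate.gam0 d * momSq q) := by positivity
  have hv := vMaj_nonneg s q μ
  have hε : 0 ≤ (∑ ν, |q ν|) / (N : ℝ) := by positivity
  have hθ : 0 ≤ ((N : ℝ) ^ 2)⁻¹ := by positivity
  have hX : 0 ≤ 4 * d * Cphi * ((N : ℝ) ^ 2)⁻¹ + Real.pi ^ 3 / 48 * ((∑ ν, |q ν|) / N)
      + 4 * d * Cpsi / T4GaugeActionRate.gam0 d * ((N : ℝ) ^ 2)⁻¹ := by positivity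
  have hY : 0 ≤ Real.pi * ((∑ ν, |q ν|) / N) := by positivity
  have eS : (Real.pi ^ 3 / 48 + Real.pi) * ((∑ ν, |q ν|) / N)
        + 4 * d * (Cphi + Cpsi / T4GaugeActionRate.gam0 d) * ((N : ℝ) ^ 2)⁻¹
      = (4 * d * Cphi * ((N : ℝ) ^ 2)⁻¹ + Real.pi ^ 3 / 48 * ((∑ ν, |q ν|) / N)
          + 4 * d * Cpsi / T4GaugeActionRate.gam0 d * ((N : ℝ) ^ 2)⁻¹)
        + Real.pi * ((∑ ν, |q ν|) / N) := by ring
  rw [eS]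
  nlinarith [mul_nonneg hX hv, mul_nonneg hY hs1]

omit [NeZero N] [NeZero R] hN hR hs hν₀ in
/-- the TAIL coefficient is `≤ A·ε + B·θ`. [folklore] -/
theorem coefT_le {ε θ : ℝ} (_hε : 0 ≤ ε) (hθ : 0 ≤ θ) :
    ε + (Real.pi / 2) ^ (d + 1) * ε + Real.pi ^ 3 / 48 * ε
      + ((Real.pi ^ 3 / 48 + Real.pi) * ε + 4 * d * (Cphi + Cpsi / T4GaugeActionRate.gam0 d) * θ)
      + 0 + 4 * d * Cphi / T4GaugeActionRate.gam0 d * θ + 4 * d * Cphi / T4GaugeActionRate.gam0 d * θ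
      + 4 * d * Cphi / T4GaugeActionRate.gam0 d ^ 2 * θ
      ≤ A163 d * ε + B163 d * θ := by
  have hg := T4GaugeActionRate.gam0_pos d
  have hg1 := T4GaugeActionRate.gam0_le_one d
  have hC := B5ActionRate166.Cphi_pos
  have hC' := B5ActionRate166.Cpsi_pos
  have hg2 : T4GaugeActionRate.gam0 d ^ 2 ≤ T4GaugeActionRate.gam0 d := by nlinarith
  have hg21 : T4GaugeActionRate.gam0 d ^ 2 ≤ 1 := hg2.trans hg1
  have e1 : 4 * d * Cphi ≤ 4 * d * Cphi / T4GaugeActionRate.gam0 d ^ 2 :=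
    le_div_self (by positivity) (by positivity) hg21
  have e2 : 4 * d * Cphi / T4GaugeActionRate.gam0 d ≤ 4 * d * Cphi / T4GaugeActionRate.gam0 d ^ 2 :=
    div_le_div_of_nonneg_left (by positivity) (by positivity) hg2
  have e3 : 4 * d * Cpsi / T4GaugeActionRate.gam0 d ≤ 4 * d * Cpsi / T4GaugeActionRate.gam0 d ^ 2 :=
    div_le_div_of_nonneg_left (by positivity) (by positivity) hg2
  have eL : ε + (Real.pi / 2) ^ (d + 1) * ε + Real.pi ^ 3 / 48 * ε
      + ((Real.pi ^ 3 / 48 + Real.pi) * ε + 4 * d * (Cphi + Cpsi / T4GaugeActionRate.gam0 d) * θ)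
      + 0 + 4 * d * Cphi / T4GaugeActionRate.gam0 d * θ + 4 * d * Cphi / T4GaugeActionRate.gam0 d * θ
      + 4 * d * Cphi / T4GaugeActionRate.gam0 d ^ 2 * θ
      = A163 d * ε + (4 * d * Cphi + 4 * d * Cpsi / T4GaugeActionRate.gam0 d
          + 2 * (4 * d * Cphi / T4GaugeActionRate.gam0 d) + 4 * d * Cphi / T4GaugeActionRate.gam0 d ^ 2)
          * θ := by
    unfold A163; ring
  have eB : B163 d = 4 * d * Cphi / T4GaugeActionRate.gam0 d ^ 2 + 4 * d * Cpsi / T4GaugeActionRate.gam0 d ^ 2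
      + 2 * (4 * d * Cphi / T4GaugeActionRate.gam0 d ^ 2) + 4 * d * Cphi / T4GaugeActionRate.gam0 d ^ 2 := by
    unfold B163; ring
  rw [eL, eB]
  gcongr ?_ + ?_ * _
  · exact le_rfl
  · linarith

omit [NeZero N] [NeZero R] hN hR hs hν₀ in
/-- the HEAD coefficient is `≤ A·ε + B·θ`. [folklore] -/
theorem coefH_le {ε θ : ℝ} (hε : 0 ≤ ε) (hθ : 0 ≤ θ) :
    (Real.pi / 2) ^ (d + 1) * ε + Real.pi / 2 * ε + Real.pi ^ 3 / 48 * ε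
      + 4 * d * Cphi / T4GaugeActionRate.gam0 d * θ
      ≤ A163 d * ε + B163 d * θ := by
  have hg := T4GaugeActionRate.gam0_pos d
  have hg1 := T4GaugeActionRate.gam0_le_one d
  have hC := B5ActionRate166.Cphi_pos
  have hC' := B5ActionRate166.Cpsi_pos
  have hπ := Real.pi_pos
  have hπ3 : 0 < Real.pi ^ 3 := by positivity
  have hg2 : T4GaugeActionRate.gam0 d ^ 2 ≤ T4GaugeActionRate.gam0 d := by nlinarith
  have e2 : 4 * d * Cphi / T4GaugeActionRate.gam0 d ≤ 4 * d * Cphi / T4GaugeActionRate.gam0 d ^ 2 :=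
    div_le_div_of_nonneg_left (by positivity) (by positivity) hg2
  have eA : (Real.pi / 2) ^ (d + 1) + Real.pi / 2 + Real.pi ^ 3 / 48 ≤ A163 d := by
    unfold A163; nlinarith
  have eB : 4 * d * Cphi / T4GaugeActionRate.gam0 d ^ 2 ≤ B163 d := by
    unfold B163
    rw [div_le_div_iff_of_pos_right (by positivity)]
    nlinarith [Nat.cast_nonneg (α := ℝ) d]
  calc (Real.pi / 2) ^ (d + 1) * ε + Real.pi / 2 * ε + Real.pi ^ 3 / 48 * ε
        + 4 * d * Cphi / T4GaugeActionRate.gam0 d * θ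
      = ((Real.pi / 2) ^ (d + 1) + Real.pi / 2 + Real.pi ^ 3 / 48) * ε
          + 4 * d * Cphi / T4GaugeActionRate.gam0 d * θ := by ring
    _ ≤ A163 d * ε + B163 d * θ := by gcongr; exact e2.trans eB

/-- **THEOREM B (the η-rate of the (1.63) multiplier, King (4.24)/(4.29)–(4.31) transferred).**
For `N, R ≥ 1`, `p′ = s` in the punctured zone and `q` any alias of `p′` in the level-`N` fine zone, the
(1.63) multiplier at cut-off `η = 1/N` and at the finer cut-off `η′ = 1/(RN)` differ by
`(A163 d·|q|₁/N + B163 d/N²) · maj163 d p′ q μ λ` — RELATIVE to the alias-decay majorant of Theorem A,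
with `d`-only constants, uniformly in `R`.  (`|q|₁/N = η|q|₁`, `1/N² = η²`: King's `η|p′+l|` of (4.24)
for the `q`-side factors and the `η²`-rate of the BKT-side functions `φ, ψ, E` of §3 of `B5ActionRate166`.)
[cite: King1986, Lemma 4.5 mechanism, (4.24) p.672 and (4.29)–(4.31) p.673] [folklore] -/
theorem hPhys_rate (μ lam : Fin d) {q : Fin d → ℝ} (hq : ∀ ν, |q ν| ≤ Real.pi * N)
    (hrep : ∀ ν, ∃ m : ℤ, q ν = s ν + 2 * Real.pi * m) :
    ‖hPhys N μ lam q s - hPhys (R * N) μ lam q s‖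
      ≤ (A163 d * ((∑ ν, |q ν|) / N) + B163 d * ((N : ℝ) ^ 2)⁻¹) * maj163 d s q μ lam := by
  have hRN := one_le_RN hN hR
  have hq' : ∀ ν, |q ν| ≤ Real.pi * (R * N : ℕ) := fun ν => zone_RN hR (hq ν)
  have hq0 := momSq_pos_of_rep hs ν₀ hν₀ hrep
  have hΔ := Delta1r_pos s hs ν₀ hν₀
  have hg := T4GaugeActionRate.gam0_pos d
  have hC := B5ActionRate166.Cphi_pos
  have hC' := B5ActionRate166.Cpsi_pos
  have hN' : (0 : ℝ) < N := by exact_mod_cast hN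
  have hε : 0 ≤ (∑ ν, |q ν|) / (N : ℝ) := by positivity
  have hθ : 0 ≤ ((N : ℝ) ^ 2)⁻¹ := by positivity
  have hεμ : |q μ| / N ≤ (∑ ν, |q ν|) / N :=
    div_le_div_of_nonneg_right (Finset.single_le_sum (fun ν _ => abs_nonneg (q ν)) (Finset.mem_univ μ))
      hN'.le
  obtain ⟨m, hm⟩ := hrep μ
  -- factor bounds, level N (a-side) and level RN (b-side)
  have bU := norm_uWeight_le_vMaj hN hs hq hrep
  have bU' := norm_uWeight_le_vMaj hRN hs hq' hrep
  have bV := norm_uFac_le_vMaj hN (hs μ) (hq μ) m hm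
  have bV' := norm_uFac_le_vMaj hRN (hs μ) (hq' μ) m hm
  have bD := norm_inv_DeltaXir_le hN hq hq0
  have bD' := norm_inv_DeltaXir_le hRN hq' hq0
  have bPm := norm_inv_phi162_le hN hs ν₀ hν₀ μ
  have bPm' := norm_inv_phi162_le hRN hs ν₀ hν₀ μ
  have bPl' := norm_inv_phi162_le hRN hs ν₀ hν₀ lam
  have bF := norm_conj_fdq_le hN (q μ)
  have bS := norm_bracket_le hN hs ν₀ hν₀ μ hq hq0 hrep
  have bS' := norm_bracket_le hRN hs ν₀ hν₀ μ hq' hq0 hrep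
  have bC := norm_conj_d1Sym_le s lam
  have bE' := norm_inv_E1_le hRN hs ν₀ hν₀
  -- factor rates
  have rF : ‖conj (fdq ((N : ℝ)⁻¹) (q μ)) - conj (fdq (((R * N : ℕ) : ℝ)⁻¹) (q μ))‖
      ≤ (∑ ν, |q ν|) / N * |q μ| := by
    rw [← map_sub, Complex.norm_conj]
    exact (fdq_rate hN hR (q μ)).trans (mul_le_mul_of_nonneg_right hεμ (abs_nonneg _))
  have rU : ‖uWeight ((N : ℝ)⁻¹) q - uWeight (((R * N : ℕ) : ℝ)⁻¹) q‖
      ≤ (Real.pi / 2) ^ (d + 1) * ((∑ ν, |q ν|) / N) * ∏ ν, vMaj s q ν :=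
    (uWeight_rate hN hR hq).trans (mul_le_mul_of_nonneg_left bU (by positivity))
  have rV : ‖uFac ((N : ℝ)⁻¹) (q μ) - uFac (((R * N : ℕ) : ℝ)⁻¹) (q μ)‖
      ≤ Real.pi / 2 * ((∑ ν, |q ν|) / N) * vMaj s q μ :=
    (uFac_rate hN hR (hq μ)).trans (by gcongr)
  have rD : ‖(((DeltaXir N 0 q : ℝ) : ℂ))⁻¹ - (((DeltaXir (R * N) 0 q : ℝ) : ℂ))⁻¹‖
      ≤ Real.pi ^ 3 / 48 * ((∑ ν, |q ν|) / N) * (Real.pi ^ 2 / 4 / momSq q) := by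
    rw [norm_inv_ofReal_sub]; exact inv_DeltaXir_sub_le hN hR hq hq0
  have rS := bracket_rate hN hR hs ν₀ hν₀ μ hq hrep
  have rC : ‖conj (d1Sym s lam) - conj (d1Sym s lam)‖ ≤ 0 * |s lam| := by simp
  have rPm := inv_phi162_rate hN hR hs ν₀ hν₀ μ
  have rPl := inv_phi162_rate hN hR hs ν₀ hν₀ lam
  have rE := inv_E1_rate hN hR hs ν₀ hν₀
  -- the tail chain («by repeated use of the identity xy − zw = …»)
  have t1 := rate_mul bF bU' rF rU hε
  have n1 := norm_mul_le_of_le bF bU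
  have t2 := rate_mul n1 bD' t1 rD (by positivity)
  have n2 := norm_mul_le_of_le n1 bD
  have t3 := rate_mul n2 bS' t2 rS (by positivity)
  have n3 := norm_mul_le_of_le n2 bS
  have t4 := rate_mul n3 bC t3 rC (by positivity)
  have n4 := norm_mul_le_of_le n3 bC
  have t5 := rate_mul n4 bPm' t4 rPm (by positivity)
  have n5 := norm_mul_le_of_le n4 bPm
  have t6 := rate_mul n5 bPl' t5 rPl (by positivity)
  have n6 := norm_mul_le_of_le n5 (norm_inv_phi162_le hN hs ν₀ hν₀ lam)
  have t7 := rate_mul n6 bE' t6 rE (by positivity)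
  have hT := t7.trans (mul_le_mul_of_nonneg_right (coefT_le (d := d) hε hθ) (tailMaj_nonneg s q μ lam))
  -- the head chain
  have h1 := rate_mul bU bV' rU rV (by positivity)
  have m1 := norm_mul_le_of_le bU bV
  have h2 := rate_mul m1 bD' h1 rD (by positivity)
  have m2 := norm_mul_le_of_le m1 bD
  have h3 := rate_mul m2 bPm' h2 rPm (by positivity)
  have hH := h3.trans (mul_le_mul_of_nonneg_right (coefH_le (d := d) hε hθ) (headMaj_nonneg s q μ))
  rw [hPhys_eq_prod, hPhys_eq_prod]
  unfold maj163
  split_ifs with hlm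
  · rw [← dist_eq_norm]
    refine (dist_add_add_le _ _ _ _).trans ?_
    rw [dist_eq_norm, dist_eq_norm, mul_add]
    exact add_le_add hH hT
  · rw [zero_add, zero_add, zero_add]
    exact hT

end Rate

/-! ## §6 Transport to b05's regrouped multiplier `B5Hk163Strip.h163` at real momenta -/

section Transport

/-- **`h163` at a real momentum IS `hPhys` of any zone representative** of the alias class: for `n ≥ 1`,
`s ∈ [−π,π]^d ∖ {0}`, `IsRep n k s q`: `B5Hk163Strip.h163 n μ λ k (ofRealVec s) = hPhys n μ λ q s`
(from b05's `second163_eq_sum_h163` and §2's `second163_torus_eq_sum_hPhys` with `B̃ = e_λ`).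
[cite: Balaban1984PropagatorsI, (1.63) p.28 (text of the formula only)] [folklore] -/
theorem h163_ofReal_eq_hPhys {n : ℕ} [NeZero n] (hn : 1 ≤ n) (s : Fin d → ℝ) (hs : ∀ ν, |s ν| ≤ Real.pi)
    (ν₀ : Fin d) (hν₀ : s ν₀ ≠ 0) (μ lam : Fin d) (k : Fin d → Fin n) {q : Fin d → ℝ} (hq : IsRep n k s q) :
    B5Hk163Strip.h163 n μ lam k (ofRealVec s) = hPhys n μ lam q s := by
  have h1 := B5Hk163Strip.second163_eq_sum_h163 n hn s hs ν₀ hν₀ μ k (Pi.single lam 1)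
  have h2 := second163_torus_eq_sum_hPhys hn s hs ν₀ hν₀ μ k (Pi.single lam 1) hq
  rw [h1] at h2
  simpa [Pi.single_apply] using h2

/-- in particular at the symmetric representative `King1986.symmAlias n k s`. [folklore] -/
theorem h163_ofReal_eq_hPhys_symmAlias {n : ℕ} [NeZero n] (hn : 1 ≤ n) (s : Fin d → ℝ)
    (hs : ∀ ν, |s ν| ≤ Real.pi) (ν₀ : Fin d) (hν₀ : s ν₀ ≠ 0) (μ lam : Fin d) (k : Fin d → Fin n) :
    B5Hk163Strip.h163 n μ lam k (ofRealVec s) = hPhys n μ lam (symmAlias n k s) s :=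
  h163_ofReal_eq_hPhys hn s hs ν₀ hν₀ μ lam k (isRep_symmAlias hn k hs)

/-- **THEOREM A for `h163`**: the alias-decay majorant of b05's regrouped (1.63) multiplier at real momenta, for every
`n ≥ 1`, `μ`, `λ`, alias index `k`, in terms of any zone representative `q` of the class.
[cite: King1986, (4.20)–(4.21) p.672 (mechanism)] [folklore] -/
theorem norm_h163_ofReal_le {n : ℕ} [NeZero n] (hn : 1 ≤ n) (s : Fin d → ℝ) (hs : ∀ ν, |s ν| ≤ Real.pi)
    (ν₀ : Fin d) (hν₀ : s ν₀ ≠ 0) (μ lam : Fin d) (k : Fin d → Fin n) {q : Fin d → ℝ} (hq : IsRep n k s q) :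
    ‖B5Hk163Strip.h163 n μ lam k (ofRealVec s)‖ ≤ maj163 d s q μ lam := by
  rw [h163_ofReal_eq_hPhys hn s hs ν₀ hν₀ μ lam k hq]
  exact norm_hPhys_le hn μ lam hs ν₀ hν₀ hq.zone hq.exists_int

/-- **THEOREM B for `h163` (the η-rate of the (1.63) multiplier across one refinement `N ↦ RN`)**: the level-`N`
multiplier at alias `k` and the level-`RN` multiplier at the PAIRED alias `iota R k s` — both functions of the same
physical momentum `q = symmAlias N k s` — differ by `(A163 d·|q|₁/N + B163 d/N²)·maj163 d s q μ λ`, for all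
`N, R ≥ 1`, `s ∈ [−π,π]^d ∖ {0}`, `μ`, `λ`, `k`.
[cite: King1986, Proposition 3.8 / (4.24), (4.29)–(4.31) pp.672–673 (mechanism)] [folklore] -/
theorem h163_rate {N R : ℕ} [NeZero N] [NeZero R] (hN : 1 ≤ N) (hR : 1 ≤ R) (s : Fin d → ℝ)
    (hs : ∀ ν, |s ν| ≤ Real.pi) (ν₀ : Fin d) (hν₀ : s ν₀ ≠ 0) (μ lam : Fin d) (k : Fin d → Fin N) :
    ‖B5Hk163Strip.h163 N μ lam k (ofRealVec s) - B5Hk163Strip.h163 (R * N) μ lam (iota R k s) (ofRealVec s)‖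
      ≤ (A163 d * ((∑ ν, |symmAlias N k s ν|) / N) + B163 d * ((N : ℝ) ^ 2)⁻¹)
          * maj163 d s (symmAlias N k s) μ lam := by
  have hq := isRep_symmAlias hN k hs
  rw [h163_ofReal_eq_hPhys hN s hs ν₀ hν₀ μ lam k hq,
    h163_ofReal_eq_hPhys (one_le_RN hN hR) s hs ν₀ hν₀ μ lam (iota R k s) (isRep_iota hN k hs)]
  exact hPhys_rate hN hR hs ν₀ hν₀ μ lam hq.zone hq.exists_int

end Transport

end Literature.MathematicalPhysics.QuantumFieldTheory.Balaban1983to89.B5Hk163Rate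

end
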